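import Literature.NumberTheory.Sieve.PintzRuzsa2003SingularSums
import Literature.NumberTheory.Sieve.GoldbachLinnikMeanSquareSplit
import Literature.NumberTheory.Sieve.SingularSeriesProofs
import HarnessLib

/-!
# Pintz–Ruzsa I, Theorem 4 (Khalfalah–Pintz): the singular sum `S(k, L) = ∑_{m ≠ 0} r_{k,k}(m) σ(m)`

Topic `Literature/NumberTheory/Sieve` (additive problems with primes and powers of `2`); support
file for the named fact `Literature.NumberTheory.Sieve.goldbach_linnik` (parity.S36). Sequel to
`PintzRuzsa2003SingularSums.lean` (`κ`, `k(d)`, `f(h)`, Romanov's constant `R₀`) and to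
`GoldbachLinnikMeanSquareSplit.lean` (`pairSingularSum N k = ∑_{m ≠ 0} r_{k,k}(m) σ(m)`, the sum
`S(k, L)` of Pintz–Ruzsa I (9.4) that controls the major-arc part (10.4) of `∫ |S G^k|²`).
Everything here is PROVED; no named facts are introduced.

J. Pintz, I. Z. Ruzsa, *On Linnik's approximation to Goldbach's problem, I*, Acta Arith. 109 (2003)
169–194, §9: with `L = [log₂ N]`, `r_{k,k}(m) = #{m = 2^{ν₁}+⋯+2^{ν_k}-2^{μ₁}-⋯-2^{μ_k}, ν_i, μ_j ∈ [1,L]}`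
((9.1)) and `σ(m) = 2C₀ ∏_{p ∣ m, p>2} (p-1)/(p-2)` ((2.7)), the quantity
`S(k, L) = ∑_{m ≠ 0} r_{k,k}(m) σ(m)` ((9.4)) satisfies

> **Theorem 4** (Khalfalah–Pintz [KP, Theorems 1–2]). For any `k ≥ 1` the limit
> `A(k) = lim_{L → ∞} (S(k,L)/(2L^{2k}) - 1)` ((9.7)) exists, it decreases with `k`, … and
> `0.0126 < A(3) < 0.0136`, `0.003 < A(4) < 0.004` ((9.10)).

"An evaluation or even a good upper estimate of `S(k, L)` turns out to be a rather difficult task.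
Using theoretical arguments and extensive computation the following result was proved in [KP]"
(p. 190). This file proves the THEORETICAL part — the existence of the limit (9.7), identified with
an explicit absolutely convergent series — and does NOT assert the numerical values (9.10), which are
a computation (they enter `goldbach_linnik` only through (10.2)/(10.14)):

* `residueSolutions d k`, `residueProb d k = P_d(k)`: the proportion of pairs of `k`-tuples of
  residues `a, b mod ϱ(d)` (`ϱ(d)` = order of `2` mod `d`, `Romanov.ordTwo`) with
  `∑ 2^{a_i} ≡ ∑ 2^{b_i} (mod d)` — the local density at `d` of the pairs counted by `r_{k,k}`;
  `P_d(k) ≤ 1/ϱ(d)` (`residueProb_le_inv`), `P_d(1) = 1/ϱ(d)` (`residueProb_one`);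
* `summable_kappa_mul_residueProb`: `∑_d κ(d) P_d(k)` converges (dominated by Romanov's series
  `∑ κ(d)/ϱ(d) = R₀` of (8.14), `PintzRuzsa2003SingularSums.lean`);
* `aConst k = A(k) := C₀ ∑'_{d odd, square-free} k(d) P_d(k) - 1` (`C₀ = twinPrimeConst`);
* `tendsto_pairSingularSum_div` / `tendsto_pairSingularSum_div_sub_one` (**Theorem 4, (9.7)**):
  `S(k,L)/(2L^{2k}) → 1 + A(k)` as `N → ∞`, for every `k ≥ 1`, through the two quantitative halves
  `eventually_pairSingularSum_le` / `eventually_le_pairSingularSum`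
  (`(1 + A(k) ∓ ε) 2L^{2k}` eventually), and `eventually_pairSingularSum_le_aConst`, the form
  `∑_{m≠0} r_{k,k}(m)σ(m) ≤ 2L^{2k}(1 + A(k) + ε)` used in (10.4);
* `one_add_aConst_one`: `1 + A(1) = C₀ R₀`; `one_add_aConst_le`: `1 + A(k) ≤ C₀ R₀ = 1 + A(1)`;
* `aConst_succ_le`, `aConst_le_aConst` (**Theorem 4: "`A(k)` decreases with `k`"**, in the weak sense
  `A(k+1) ≤ A(k)`): from `P_d(k+1) ≤ P_d(k)` (`residueProb_succ_le`: fixing the first exponents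
  leaves shifted coincidences, which are fewer than coincidences by `2xy ≤ x² + y²` and translation
  invariance modulo `d`, `card_filter_shift_le`). Not formalised: the strict decrease, (9.8)
  `A(k) > 2^{-2k-1}`, (9.9) `A(k) → 0`, and the numerics (9.10).

## Proof

Elementary, in the spirit of Romanov's lemma and of §8 (8.7)–(8.14) of the paper (the argument of
[KP] itself is not reproduced here; only its statement (9.7) is formalised). Since
`σ(m) = 2C₀ f(|m|) = 2C₀ ∑'_{d ∣ m} k(d)` ((8.10), `fWeight_eq_sum_divisors` in the prequel; here
used in the product form `f = ∏ (1 + k(p))`), `S(k,L) = 2C₀ ∑'_d k(d) · #{(ν,μ) : d ∣ m ≠ 0}`.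
For a fixed odd `d`, `2^ν mod d` depends only on `ν mod ϱ(d)` and the exponents in `[1, L]` are
equidistributed modulo `ϱ(d)` up to `±1` per class (`card_Icc_filter_mod_le`,
`le_card_Icc_filter_mod`), so `#{(ν,μ) ∈ [1,L]^{2k} : d ∣ m}` lies between
`#residueSolutions · ⌊L/ϱ⌋^{2k}` and `#residueSolutions · (⌊L/ϱ⌋+1)^{2k}` (`le_card_congrPairs`,
`card_congrPairs_le`), i.e. is `P_d(k) L^{2k} (1 + o(1))`; the diagonal `m = 0` has only
`r_{k,k}(0) ≤ L^{2k-1}` pairs (`coincidences_le_pow`, cf. Lemma 12). The issue is uniformity in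
`d`. Upper bound (`pairSingularSum_le_fixed`): the prime factors `p` of `m` with `ϱ(p) > L` are
`> L` and at most `log(k2^L)/log(L+1)` in number, so they contribute a factor
`≤ exp(log(k 2^L)/((L-1) log(L+1))) → 1` (`prod_largeOrdFactors_le`, `tendsto_largeOrdBound`);
expanding the remaining product over the odd primes `P_L` of order `≤ L` (a finite set,
`Romanov.primesOrdLE`) and exchanging summations (`sum_prod_one_add_eq`) leaves
`∑_{T ⊆ P_L} k(d_T) #{d_T ∣ m}`, where the terms with `ϱ(d_T) ≤ Z` are bounded through the residue
count by `(L+Z)^{2k} ∑' κ P`, and those with `ϱ(d_T) > Z` through the crude count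
`#{d ∣ m} ≤ L^{2k-1}(⌊L/ϱ(d)⌋ + 1)` (`card_congrPairs_le_crude`) by
`L^{2k} ∑_{ϱ(d) > Z} κ(d)/ϱ(d) + L^{2k-1} ∏_{p ∈ P_L}(1 + k(p))`, the last product being
`≤ e¹⁴ log² L` (`prod_one_add_inv_primesOrdLE_le`, from `Romanov.sum_primesOrdLE_inv_pred_le`) and the
tail of Romanov's series being small for large `Z`. Lower bound (`pairSingularSum_ge_fixed`): keep
only the divisors `d_T`, `T ⊆ P_{Y₀}`, for a fixed `Y₀`, subtract the diagonal, and let first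
`L → ∞`, then `Y₀ → ∞` (every odd square-free `d` is such a `d_T`).

## References

* J. Pintz, I. Z. Ruzsa, *On Linnik's approximation to Goldbach's problem, I*, Acta Arith. 109
  (2003) 169–194, §2 (2.7), §8 (8.10)–(8.14), §9 (9.1)–(9.10), Lemma 12, Theorem 4, §10 (10.4).
  [PintzRuzsa2003]
* A. Khalfalah, J. Pintz, *On the representation of Goldbach numbers by a bounded number of powers
  of two*, in: Elementare und analytische Zahlentheorie, Schr. Wiss. Ges. Johann Wolfgang Goethe
  Univ. Frankfurt am Main 20, Franz Steiner, Stuttgart (2006) 129–142, Theorems 1–2.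
  [KhalfalahPintz2006]
* N. P. Romanoff, *Über einige Sätze der additiven Zahlentheorie*, Math. Ann. 109 (1934) 668–678.
  [Romanoff1934]
-/

noncomputable section

open Finset Filter Topology

namespace Literature.NumberTheory.Sieve

namespace PintzRuzsa2003

open Romanov GoldbachLinnik

/-! ### Exponents in a residue class -/

/-- The exponents `ν ∈ [1, L]` in one residue class modulo `ρ` number at most `⌊L/ρ⌋ + 1`
(`ν ↦ ⌊ν/ρ⌋` is injective on the class). [folklore] -/
theorem card_Icc_filter_mod_le (L ρ a : ℕ) :
    ((Icc 1 L).filter fun ν => ν % ρ = a).card ≤ L / ρ + 1 := by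
  calc ((Icc 1 L).filter fun ν => ν % ρ = a).card ≤ (range (L / ρ + 1)).card := by
        refine Finset.card_le_card_of_injOn (fun ν => ν / ρ) (fun ν hν => ?_) fun ν₁ h₁ ν₂ h₂ h => ?_
        · rw [Finset.mem_coe, Finset.mem_filter, Finset.mem_Icc] at hν
          rw [Finset.mem_coe, Finset.mem_range]
          exact Nat.lt_succ_of_le (Nat.div_le_div_right hν.1.2)
        · rw [Finset.mem_coe, Finset.mem_filter] at h₁ h₂
          dsimp only at h
          calc ν₁ = ρ * (ν₁ / ρ) + ν₁ % ρ := (Nat.div_add_mod ν₁ ρ).symm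
            _ = ρ * (ν₂ / ρ) + ν₂ % ρ := by rw [h, h₁.2, h₂.2]
            _ = ν₂ := Nat.div_add_mod ν₂ ρ
    _ = L / ρ + 1 := Finset.card_range _

/-- The exponents `ν ∈ [1, L]` in the residue class `a mod ρ` (`a < ρ`) number at least `⌊L/ρ⌋`
(`q ↦ qρ + a'`, `a' ∈ [1, ρ]`, `a' ≡ a`, is injective from `[0, ⌊L/ρ⌋)` into the class). [folklore] -/
theorem le_card_Icc_filter_mod (L : ℕ) {ρ a : ℕ} (ha : a < ρ) :
    L / ρ ≤ ((Icc 1 L).filter fun ν => ν % ρ = a).card := by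
  have hρ : 0 < ρ := lt_of_le_of_lt (Nat.zero_le a) ha
  set a' : ℕ := if a = 0 then ρ else a with ha'
  have ha'1 : 1 ≤ a' := by rw [ha']; split_ifs <;> omega
  have ha'2 : a' ≤ ρ := by rw [ha']; split_ifs <;> omega
  have ha'3 : a' % ρ = a := by
    rw [ha']
    split_ifs with h
    · rw [Nat.mod_self, h]
    · exact Nat.mod_eq_of_lt ha
  calc L / ρ = (range (L / ρ)).card := (Finset.card_range _).symm
    _ ≤ ((Icc 1 L).filter fun ν => ν % ρ = a).card := by
        refine Finset.card_le_card_of_injOn (fun q => q * ρ + a') (fun q hq => ?_)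
          fun q₁ _ q₂ _ h => ?_
        · rw [Finset.mem_coe, Finset.mem_range] at hq
          rw [Finset.mem_coe, Finset.mem_filter, Finset.mem_Icc]
          refine ⟨⟨ha'1.trans (Nat.le_add_left a' (q * ρ)), ?_⟩, ?_⟩
          · have h1 : (q + 1) * ρ ≤ L / ρ * ρ := Nat.mul_le_mul_right ρ hq
            have h2 : L / ρ * ρ ≤ L := Nat.div_mul_le_self L ρ
            calc q * ρ + a' ≤ q * ρ + ρ := Nat.add_le_add_left ha'2 _
              _ = (q + 1) * ρ := (Nat.succ_mul q ρ).symm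
              _ ≤ L := h1.trans h2
          · show (q * ρ + a') % ρ = a
            rw [Nat.add_comm, Nat.add_mul_mod_self_right, ha'3]
        · dsimp only at h
          exact Nat.eq_of_mul_eq_mul_right hρ (Nat.add_right_cancel h)

/-! ### Powers of `2` modulo `d`: reduction of the exponent modulo `ϱ(d)` -/

/-- `2^ν ≡ 2^{ν mod ϱ(d)} (mod d)`. [folklore] -/
theorem two_pow_modEq_two_pow_mod (d ν : ℕ) : 2 ^ ν ≡ 2 ^ (ν % ordTwo d) [MOD d] := by
  have h1 : 2 ^ ordTwo d ≡ 1 [MOD d] :=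
    ((Nat.modEq_iff_dvd' Nat.one_le_two_pow).mpr (dvd_two_pow_ordTwo_sub_one d)).symm
  calc 2 ^ ν = (2 ^ ordTwo d) ^ (ν / ordTwo d) * 2 ^ (ν % ordTwo d) := by
        rw [← pow_mul, ← pow_add, Nat.div_add_mod]
    _ ≡ 1 ^ (ν / ordTwo d) * 2 ^ (ν % ordTwo d) [MOD d] := (h1.pow _).mul_right _
    _ = 2 ^ (ν % ordTwo d) := by rw [one_pow, one_mul]

/-- If `2^n ≡ 2^m (mod d)`, `d` odd, then `n ≡ m (mod ϱ(d))` (`2` is a unit modulo `d`). [folklore] -/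
theorem modEq_ordTwo_of_two_pow_modEq {d n m : ℕ} (hd : Odd d) (h : 2 ^ n ≡ 2 ^ m [MOD d]) :
    n ≡ m [MOD ordTwo d] := by
  have hd0 : d ≠ 0 := by rintro rfl; exact (Nat.not_odd_zero hd).elim
  haveI : NeZero d := ⟨hd0⟩
  have hcop : Nat.Coprime 2 d := Nat.coprime_two_left.mpr hd
  set u : (ZMod d)ˣ := ZMod.unitOfCoprime 2 hcop with hu
  have hu2 : (u : ZMod d) = 2 := by rw [hu, ZMod.coe_unitOfCoprime]; norm_cast
  have hzmod : ((2 ^ n : ℕ) : ZMod d) = ((2 ^ m : ℕ) : ZMod d) :=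
    (ZMod.natCast_eq_natCast_iff _ _ _).mpr h
  push_cast at hzmod
  have hunits : u ^ n = u ^ m := by
    ext
    rw [Units.val_pow_eq_pow_val, Units.val_pow_eq_pow_val, hu2]
    exact hzmod
  have hord : orderOf u = ordTwo d := by
    unfold ordTwo
    rw [← orderOf_units, hu2]
  rw [← hord]
  exact pow_eq_pow_iff_modEq.mp hunits

/-- `∑ 2^{ν_i} ≡ ∑ 2^{ν_i mod ϱ(d)} (mod d)`. [folklore] -/
theorem tupleSum_mod_eq {k : ℕ} (d : ℕ) (ν : Fin k → ℕ) :
    tupleSum ν % d = tupleSum (fun i => ν i % ordTwo d) % d := by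
  unfold tupleSum
  rw [Finset.sum_nat_mod, Finset.sum_congr rfl fun i _ => two_pow_modEq_two_pow_mod d (ν i),
    ← Finset.sum_nat_mod]

/-- `∑ 2^{ν_i}` over a `(j+1)`-tuple: the first power plus the rest. [folklore] -/
theorem tupleSum_succ {j : ℕ} (ν : Fin (j + 1) → ℕ) :
    tupleSum ν = 2 ^ ν 0 + ∑ i : Fin j, 2 ^ ν i.succ := by
  unfold tupleSum
  rw [Fin.sum_univ_succ]

/-- Two `(j+1)`-tuples with the same tail and the same first entry are equal. [folklore] -/
theorem eq_of_apply_zero_eq_of_tail_eq {j : ℕ} {ν ν' : Fin (j + 1) → ℕ} (h0 : ν 0 = ν' 0)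
    (ht : (fun i : Fin j => ν i.succ) = fun i => ν' i.succ) : ν = ν' := by
  funext i
  refine Fin.cases h0 (fun i => ?_) i
  exact congrFun ht i

/-! ### The residue count `P_d(k)` -/

/-- The pairs of `k`-tuples of residues `(a, b) ∈ [0, ϱ(d))^k × [0, ϱ(d))^k` with
`2^{a₁} + ⋯ + 2^{a_k} ≡ 2^{b₁} + ⋯ + 2^{b_k} (mod d)`. [cite: PintzRuzsa2003, §9 (9.4), Theorem 4] -/
def residueSolutions (d k : ℕ) : Finset ((Fin k → ℕ) × (Fin k → ℕ)) :=
  ((Fintype.piFinset fun _ : Fin k => range (ordTwo d)) ×ˢ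
      (Fintype.piFinset fun _ : Fin k => range (ordTwo d))).filter
    fun z => tupleSum z.1 % d = tupleSum z.2 % d

/-- `P_d(k) = #residueSolutions d k / ϱ(d)^{2k}`: the probability that
`2^{a₁} + ⋯ + 2^{a_k} ≡ 2^{b₁} + ⋯ + 2^{b_k} (mod d)` for independent exponents uniformly
distributed modulo `ϱ(d)` (the local density at `d` of the pairs counted by `r_{k,k}`).
[cite: PintzRuzsa2003, §9 (9.4), Theorem 4] -/
def residueProb (d k : ℕ) : ℝ :=
  ((residueSolutions d k).card : ℝ) / ((ordTwo d : ℝ) ^ (2 * k))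

/-- `P_d(k) ≥ 0`. [folklore] -/
theorem residueProb_nonneg (d k : ℕ) : 0 ≤ residueProb d k := by
  unfold residueProb; positivity

/-- Membership in `residueSolutions`. [folklore] -/
theorem mem_residueSolutions {d k : ℕ} {z : (Fin k → ℕ) × (Fin k → ℕ)} :
    z ∈ residueSolutions d k ↔
      (∀ i, z.1 i < ordTwo d) ∧ (∀ i, z.2 i < ordTwo d) ∧ tupleSum z.1 % d = tupleSum z.2 % d := by
  unfold residueSolutions
  simp only [Finset.mem_filter, Finset.mem_product, Fintype.mem_piFinset, Finset.mem_range]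
  tauto

/-- `#residueSolutions d k ≤ ϱ(d)^{2k-1}` for `k ≥ 1` and odd `d`: all entries but `a₁` determine
`2^{a₁} mod d`, hence `a₁ ∈ [0, ϱ(d))`. [cite: PintzRuzsa2003, §9 (proof of Lemma 12)] -/
theorem card_residueSolutions_le {d k : ℕ} (hd : Odd d) (hk : 1 ≤ k) :
    (residueSolutions d k).card ≤ ordTwo d ^ (2 * k - 1) := by
  classical
  obtain ⟨j, rfl⟩ : ∃ j, k = j + 1 := ⟨k - 1, by omega⟩
  set ρ := ordTwo d with hρ
  set T : Finset ((Fin j → ℕ) × (Fin (j + 1) → ℕ)) :=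
    (Fintype.piFinset fun _ : Fin j => range ρ) ×ˢ (Fintype.piFinset fun _ : Fin (j + 1) => range ρ)
    with hT
  have hTcard : T.card = ρ ^ (2 * (j + 1) - 1) := by
    rw [hT, Finset.card_product, Fintype.card_piFinset_const, Fintype.card_piFinset_const,
      Finset.card_range, ← pow_add]
    congr 1
    omega
  rw [← hTcard]
  refine Finset.card_le_card_of_injOn (fun z => (fun i => z.1 i.succ, z.2)) (fun z hz => ?_)
    fun z hz z' hz' hzz => ?_
  · rw [Finset.mem_coe, mem_residueSolutions] at hz
    simp only [hT, Finset.coe_product, Set.mem_prod, Finset.mem_coe, Fintype.mem_piFinset,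
      Finset.mem_range]
    exact ⟨fun i => hz.1 _, hz.2.1⟩
  · rw [Finset.mem_coe, mem_residueSolutions] at hz hz'
    simp only [Prod.mk.injEq] at hzz
    obtain ⟨htail, h2⟩ := hzz
    have hsum : 2 ^ z.1 0 + ∑ i : Fin j, 2 ^ z.1 i.succ ≡
        2 ^ z'.1 0 + ∑ i : Fin j, 2 ^ z.1 i.succ [MOD d] := by
      have e1 := hz.2.2
      have e2 := hz'.2.2
      rw [tupleSum_succ] at e1 e2
      rw [h2] at e1
      have e3 : (∑ i : Fin j, 2 ^ z'.1 i.succ) = ∑ i : Fin j, 2 ^ z.1 i.succ := by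
        refine Finset.sum_congr rfl fun i _ => ?_
        rw [show z'.1 i.succ = z.1 i.succ from (congrFun htail i).symm]
      rw [e3] at e2
      exact e1.trans e2.symm
    have h0 : z.1 0 ≡ z'.1 0 [MOD ρ] :=
      modEq_ordTwo_of_two_pow_modEq hd (Nat.ModEq.add_right_cancel' _ hsum)
    have h00 : z.1 0 = z'.1 0 := Nat.ModEq.eq_of_lt_of_lt h0 (hz.1 0) (hz'.1 0)
    exact Prod.ext (eq_of_apply_zero_eq_of_tail_eq h00 htail) h2

/-- `P_d(k) ≤ 1/ϱ(d)` for `k ≥ 1` and odd `d`. [cite: PintzRuzsa2003, §9] -/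
theorem residueProb_le_inv {d k : ℕ} (hd : Odd d) (hk : 1 ≤ k) :
    residueProb d k ≤ 1 / ordTwo d := by
  have hρ : (0 : ℝ) < ordTwo d := by exact_mod_cast ordTwo_pos hd
  unfold residueProb
  rw [div_le_div_iff₀ (by positivity) hρ, one_mul]
  calc ((residueSolutions d k).card : ℝ) * ordTwo d ≤ (ordTwo d : ℝ) ^ (2 * k - 1) * ordTwo d := by
        gcongr
        exact_mod_cast card_residueSolutions_le hd hk
    _ = (ordTwo d : ℝ) ^ (2 * k) := by
        rw [← pow_succ]
        congr 1
        omega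

/-- For `k = 1` and odd `d` the only solutions are the diagonal ones: `#residueSolutions d 1 = ϱ(d)`.
[folklore] -/
theorem card_residueSolutions_one {d : ℕ} (hd : Odd d) : (residueSolutions d 1).card = ordTwo d := by
  classical
  have himage : residueSolutions d 1 =
      (range (ordTwo d)).image fun a => ((fun _ : Fin 1 => a), (fun _ : Fin 1 => a)) := by
    ext z
    rw [mem_residueSolutions, Finset.mem_image]
    constructor
    · rintro ⟨h1, h2, h3⟩
      refine ⟨z.1 0, Finset.mem_range.mpr (h1 0), ?_⟩
      have hsum : 2 ^ z.1 0 ≡ 2 ^ z.2 0 [MOD d] := by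
        have : ∀ ν : Fin 1 → ℕ, tupleSum ν = 2 ^ ν 0 := fun ν => by
          rw [tupleSum_succ]; simp
        rw [this, this] at h3
        exact h3
      have h00 : z.1 0 = z.2 0 :=
        Nat.ModEq.eq_of_lt_of_lt (modEq_ordTwo_of_two_pow_modEq hd hsum) (h1 0) (h2 0)
      refine Prod.ext (funext fun i => ?_) (funext fun i => ?_)
      · rw [Fin.fin_one_eq_zero i]
      · rw [Fin.fin_one_eq_zero i, h00]
    · rintro ⟨a, ha, rfl⟩
      rw [Finset.mem_range] at ha
      exact ⟨fun _ => ha, fun _ => ha, rfl⟩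
  rw [himage, Finset.card_image_of_injective _ fun a b hab => ?_, Finset.card_range]
  have := congrArg (fun z : (Fin 1 → ℕ) × (Fin 1 → ℕ) => z.1 0) hab
  exact this

/-- `P_d(1) = 1/ϱ(d)` for odd `d`. [folklore] -/
theorem residueProb_one {d : ℕ} (hd : Odd d) : residueProb d 1 = 1 / ordTwo d := by
  have hρ : (0 : ℝ) < ordTwo d := by exact_mod_cast ordTwo_pos hd
  unfold residueProb
  rw [card_residueSolutions_one hd, mul_one, pow_two, div_mul_eq_div_div, div_self hρ.ne']


/-! ### Pairs of exponent tuples in a congruence class: `#{(ν, μ) : d ∣ ∑2^{ν_i} - ∑2^{μ_i}}` -/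

/-- The pairs `(ν, μ) ∈ [1, L]^k × [1, L]^k` with `∑ 2^{ν_i} ≡ ∑ 2^{μ_i} (mod d)`.
[cite: PintzRuzsa2003, §9 (9.4)] -/
def congrPairs (N k d : ℕ) : Finset ((Fin k → ℕ) × (Fin k → ℕ)) :=
  (expTuples N k ×ˢ expTuples N k).filter fun z => tupleSum z.1 % d = tupleSum z.2 % d

/-- The residue pattern `(ν mod ρ, μ mod ρ)` of a pair of tuples. [folklore] -/
def resPattern (ρ : ℕ) {k : ℕ} (z : (Fin k → ℕ) × (Fin k → ℕ)) : (Fin k → ℕ) × (Fin k → ℕ) :=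
  (fun i => z.1 i % ρ, fun i => z.2 i % ρ)

/-- The pairs of tuples in `[1, L]^k × [1, L]^k` with a prescribed residue pattern modulo `ρ`.
[folklore] -/
def patternFibre (N k ρ : ℕ) (w : (Fin k → ℕ) × (Fin k → ℕ)) :
    Finset ((Fin k → ℕ) × (Fin k → ℕ)) :=
  (Fintype.piFinset fun i => (Icc 1 (powLen N)).filter fun ν => ν % ρ = w.1 i) ×ˢ
    (Fintype.piFinset fun i => (Icc 1 (powLen N)).filter fun ν => ν % ρ = w.2 i)

/-- Membership in `congrPairs`. [folklore] -/
theorem mem_congrPairs {N k d : ℕ} {z : (Fin k → ℕ) × (Fin k → ℕ)} :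
    z ∈ congrPairs N k d ↔
      z.1 ∈ expTuples N k ∧ z.2 ∈ expTuples N k ∧ tupleSum z.1 % d = tupleSum z.2 % d := by
  unfold congrPairs
  rw [Finset.mem_filter, Finset.mem_product, and_assoc]

/-- The residue pattern of a pair in `congrPairs N k d` solves the congruence. [folklore] -/
theorem resPattern_mem_residueSolutions {N k d : ℕ} (hd : Odd d) {z : (Fin k → ℕ) × (Fin k → ℕ)}
    (hz : z ∈ congrPairs N k d) : resPattern (ordTwo d) z ∈ residueSolutions d k := by
  have hρ := ordTwo_pos hd
  rw [mem_congrPairs] at hz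
  rw [mem_residueSolutions]
  refine ⟨fun i => Nat.mod_lt _ hρ, fun i => Nat.mod_lt _ hρ, ?_⟩
  show tupleSum (fun i => z.1 i % ordTwo d) % d = tupleSum (fun i => z.2 i % ordTwo d) % d
  rw [← tupleSum_mod_eq, ← tupleSum_mod_eq, hz.2.2]

/-- The fibre of `congrPairs N k d` over a solution pattern is the full pattern class in
`[1, L]^k × [1, L]^k`. [folklore] -/
theorem filter_resPattern_eq {N k d : ℕ} {w : (Fin k → ℕ) × (Fin k → ℕ)}
    (hw : w ∈ residueSolutions d k) :
    (congrPairs N k d).filter (fun z => resPattern (ordTwo d) z = w) = patternFibre N k (ordTwo d) w := by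
  ext z
  rw [Finset.mem_filter, mem_congrPairs]
  unfold patternFibre
  rw [Finset.mem_product, Fintype.mem_piFinset, Fintype.mem_piFinset]
  simp only [Finset.mem_filter, Finset.mem_Icc]
  constructor
  · rintro ⟨⟨h1, h2, -⟩, hpat⟩
    rw [mem_expTuples] at h1 h2
    have hp1 : ∀ i, z.1 i % ordTwo d = w.1 i := fun i => congrFun (congrArg Prod.fst hpat) i
    have hp2 : ∀ i, z.2 i % ordTwo d = w.2 i := fun i => congrFun (congrArg Prod.snd hpat) i
    exact ⟨fun i => ⟨h1 i, hp1 i⟩, fun i => ⟨h2 i, hp2 i⟩⟩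
  · rintro ⟨h1, h2⟩
    have hpat : resPattern (ordTwo d) z = w :=
      Prod.ext (funext fun i => (h1 i).2) (funext fun i => (h2 i).2)
    refine ⟨⟨mem_expTuples.mpr fun i => (h1 i).1, mem_expTuples.mpr fun i => (h2 i).1, ?_⟩, hpat⟩
    rw [tupleSum_mod_eq d z.1, tupleSum_mod_eq d z.2]
    have e1 : (fun i => z.1 i % ordTwo d) = w.1 := congrArg Prod.fst hpat
    have e2 : (fun i => z.2 i % ordTwo d) = w.2 := congrArg Prod.snd hpat
    rw [e1, e2]
    exact (mem_residueSolutions.mp hw).2.2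

/-- `#patternFibre = ∏_i #{ν : ν ≡ a_i} · ∏_i #{μ : μ ≡ b_i}`. [folklore] -/
theorem card_patternFibre (N k ρ : ℕ) (w : (Fin k → ℕ) × (Fin k → ℕ)) :
    (patternFibre N k ρ w).card =
      (∏ i, ((Icc 1 (powLen N)).filter fun ν => ν % ρ = w.1 i).card) *
        ∏ i, ((Icc 1 (powLen N)).filter fun ν => ν % ρ = w.2 i).card := by
  unfold patternFibre
  rw [Finset.card_product, Fintype.card_piFinset, Fintype.card_piFinset]

/-- `#patternFibre ≤ (⌊L/ρ⌋ + 1)^{2k}`. [folklore] -/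
theorem card_patternFibre_le (N k ρ : ℕ) (w : (Fin k → ℕ) × (Fin k → ℕ)) :
    (patternFibre N k ρ w).card ≤ (powLen N / ρ + 1) ^ (2 * k) := by
  rw [card_patternFibre, two_mul, pow_add]
  refine Nat.mul_le_mul ?_ ?_ <;>
  · calc _ ≤ ∏ _i : Fin k, (powLen N / ρ + 1) :=
          Finset.prod_le_prod' fun i _ => card_Icc_filter_mod_le _ _ _
      _ = (powLen N / ρ + 1) ^ k := by rw [Finset.prod_const, Finset.card_univ, Fintype.card_fin]

/-- `#patternFibre ≥ ⌊L/ρ⌋^{2k}` when all prescribed residues are `< ρ`. [folklore] -/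
theorem le_card_patternFibre (N k ρ : ℕ) {w : (Fin k → ℕ) × (Fin k → ℕ)}
    (h1 : ∀ i, w.1 i < ρ) (h2 : ∀ i, w.2 i < ρ) :
    (powLen N / ρ) ^ (2 * k) ≤ (patternFibre N k ρ w).card := by
  rw [card_patternFibre, two_mul, pow_add]
  refine Nat.mul_le_mul ?_ ?_
  · calc (powLen N / ρ) ^ k = ∏ _i : Fin k, (powLen N / ρ) := by
          rw [Finset.prod_const, Finset.card_univ, Fintype.card_fin]
      _ ≤ _ := Finset.prod_le_prod' fun i _ => le_card_Icc_filter_mod _ (h1 i)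
  · calc (powLen N / ρ) ^ k = ∏ _i : Fin k, (powLen N / ρ) := by
          rw [Finset.prod_const, Finset.card_univ, Fintype.card_fin]
      _ ≤ _ := Finset.prod_le_prod' fun i _ => le_card_Icc_filter_mod _ (h2 i)

/-- **Upper count**: `#{(ν,μ) ∈ [1,L]^{2k} : d ∣ m} ≤ #residueSolutions · (⌊L/ϱ⌋ + 1)^{2k}` for odd
`d` (fibres over residue patterns). [cite: PintzRuzsa2003, §9 (9.4)] -/
theorem card_congrPairs_le {N k d : ℕ} (hd : Odd d) :
    (congrPairs N k d).card ≤ (residueSolutions d k).card * (powLen N / ordTwo d + 1) ^ (2 * k) := by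
  classical
  rw [Finset.card_eq_sum_card_fiberwise (f := resPattern (ordTwo d)) (t := residueSolutions d k)
    fun z hz => resPattern_mem_residueSolutions hd hz]
  calc ∑ w ∈ residueSolutions d k, ((congrPairs N k d).filter fun z => resPattern (ordTwo d) z = w).card
      = ∑ w ∈ residueSolutions d k, (patternFibre N k (ordTwo d) w).card :=
        Finset.sum_congr rfl fun w hw => by rw [filter_resPattern_eq hw]
    _ ≤ ∑ _w ∈ residueSolutions d k, (powLen N / ordTwo d + 1) ^ (2 * k) :=
        Finset.sum_le_sum fun w _ => card_patternFibre_le _ _ _ _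
    _ = _ := by rw [Finset.sum_const, smul_eq_mul]

/-- **Lower count**: `#{(ν,μ) ∈ [1,L]^{2k} : d ∣ m} ≥ #residueSolutions · ⌊L/ϱ⌋^{2k}` for odd `d`.
[cite: PintzRuzsa2003, §9 (9.4)] -/
theorem le_card_congrPairs {N k d : ℕ} (hd : Odd d) :
    (residueSolutions d k).card * (powLen N / ordTwo d) ^ (2 * k) ≤ (congrPairs N k d).card := by
  classical
  rw [Finset.card_eq_sum_card_fiberwise (f := resPattern (ordTwo d)) (t := residueSolutions d k)
    fun z hz => resPattern_mem_residueSolutions hd hz]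
  calc (residueSolutions d k).card * (powLen N / ordTwo d) ^ (2 * k)
      = ∑ _w ∈ residueSolutions d k, (powLen N / ordTwo d) ^ (2 * k) := by
        rw [Finset.sum_const, smul_eq_mul]
    _ ≤ ∑ w ∈ residueSolutions d k, (patternFibre N k (ordTwo d) w).card :=
        Finset.sum_le_sum fun w hw => by
          have hw' := mem_residueSolutions.mp hw
          exact le_card_patternFibre _ _ _ hw'.1 hw'.2.1
    _ = ∑ w ∈ residueSolutions d k,
          ((congrPairs N k d).filter fun z => resPattern (ordTwo d) z = w).card :=
        Finset.sum_congr rfl fun w hw => by rw [filter_resPattern_eq hw]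

/-- **Crude count**: `#{(ν,μ) ∈ [1,L]^{2k} : d ∣ m} ≤ L^{2k-1} (⌊L/ϱ⌋ + 1)` for odd `d` and `k ≥ 1`
(all entries but `ν₁` free; then `2^{ν₁} mod d`, i.e. `ν₁ mod ϱ(d)`, is determined).
[cite: PintzRuzsa2003, §9 (proof of Lemma 12)] -/
theorem card_congrPairs_le_crude {N k d : ℕ} (hd : Odd d) (hk : 1 ≤ k) :
    (congrPairs N k d).card ≤ powLen N ^ (2 * k - 1) * (powLen N / ordTwo d + 1) := by
  classical
  obtain ⟨j, rfl⟩ : ∃ j, k = j + 1 := ⟨k - 1, by omega⟩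
  set L := powLen N with hL
  set ρ := ordTwo d with hρ
  set φ : ((Fin (j + 1) → ℕ) × (Fin (j + 1) → ℕ)) → (Fin j → ℕ) × (Fin (j + 1) → ℕ) :=
    fun z => (fun i => z.1 i.succ, z.2) with hφ
  have hfib : ∀ a ∈ (congrPairs N (j + 1) d).image φ,
      ((congrPairs N (j + 1) d).filter fun z => φ z = a).card ≤ L / ρ + 1 := by
    intro a ha
    obtain ⟨z₀, hz₀, rfl⟩ := Finset.mem_image.mp ha
    calc ((congrPairs N (j + 1) d).filter fun z => φ z = φ z₀).card
        ≤ ((Icc 1 L).filter fun ν => ν % ρ = z₀.1 0 % ρ).card := by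
          refine Finset.card_le_card_of_injOn (fun z => z.1 0) (fun z hz => ?_) fun z hz z' hz' hzz => ?_
          · rw [Finset.mem_coe, Finset.mem_filter] at hz
            obtain ⟨hz, hφz⟩ := hz
            rw [Finset.mem_coe, Finset.mem_filter, Finset.mem_Icc]
            have hz1 : z.1 ∈ expTuples N (j + 1) := (mem_congrPairs.mp hz).1
            refine ⟨(mem_expTuples.mp hz1) 0, ?_⟩
            -- the congruence forces `z.1 0 ≡ z₀.1 0 (mod ρ)`
            simp only [hφ, Prod.mk.injEq] at hφz
            obtain ⟨htail, h2⟩ := hφz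
            have e1 := (mem_congrPairs.mp hz).2.2
            have e2 := (mem_congrPairs.mp hz₀).2.2
            rw [tupleSum_succ] at e1 e2
            rw [h2] at e1
            have e3 : (∑ i : Fin j, 2 ^ z₀.1 i.succ) = ∑ i : Fin j, 2 ^ z.1 i.succ :=
              Finset.sum_congr rfl fun i _ => by
                rw [show z₀.1 i.succ = z.1 i.succ from (congrFun htail i).symm]
            rw [e3] at e2
            have hsum : 2 ^ z.1 0 + ∑ i : Fin j, 2 ^ z.1 i.succ ≡
                2 ^ z₀.1 0 + ∑ i : Fin j, 2 ^ z.1 i.succ [MOD d] := e1.trans e2.symm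
            exact modEq_ordTwo_of_two_pow_modEq hd (Nat.ModEq.add_right_cancel' _ hsum)
          · rw [Finset.mem_coe, Finset.mem_filter] at hz hz'
            have hφφ : φ z = φ z' := hz.2.trans hz'.2.symm
            simp only [hφ, Prod.mk.injEq] at hφφ
            exact Prod.ext (eq_of_apply_zero_eq_of_tail_eq hzz hφφ.1) hφφ.2
      _ ≤ L / ρ + 1 := card_Icc_filter_mod_le _ _ _
  have himg : ((congrPairs N (j + 1) d).image φ).card ≤ L ^ (2 * (j + 1) - 1) := by
    calc ((congrPairs N (j + 1) d).image φ).card ≤ (expTuples N j ×ˢ expTuples N (j + 1)).card := by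
          refine Finset.card_le_card fun a ha => ?_
          obtain ⟨z, hz, rfl⟩ := Finset.mem_image.mp ha
          rw [Finset.mem_product]
          have hz' := mem_congrPairs.mp hz
          refine ⟨mem_expTuples.mpr fun i => (mem_expTuples.mp hz'.1) i.succ, hz'.2.1⟩
      _ = L ^ (2 * (j + 1) - 1) := by
          rw [Finset.card_product, card_expTuples, card_expTuples, ← pow_add]
          congr 1
          omega
  calc (congrPairs N (j + 1) d).card ≤ (L / ρ + 1) * ((congrPairs N (j + 1) d).image φ).card :=
        Finset.card_le_mul_card_image _ _ hfib
    _ ≤ (L / ρ + 1) * L ^ (2 * (j + 1) - 1) := Nat.mul_le_mul_left _ himg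
    _ = L ^ (2 * (j + 1) - 1) * (L / ρ + 1) := mul_comm _ _

/-- **`r_{k,k}(0) ≤ L^{2k-1}`** for `k ≥ 1` (a weak form of Lemma 12, valid also for `k = 1`: all
entries but `ν₁` determine `2^{ν₁}`). [cite: PintzRuzsa2003, §9 Lemma 12] -/
theorem coincidences_le_pow {N k : ℕ} (hk : 1 ≤ k) : coincidences N k ≤ powLen N ^ (2 * k - 1) := by
  classical
  obtain ⟨j, rfl⟩ : ∃ j, k = j + 1 := ⟨k - 1, by omega⟩
  unfold coincidences
  set L := powLen N with hL
  set φ : ((Fin (j + 1) → ℕ) × (Fin (j + 1) → ℕ)) → (Fin j → ℕ) × (Fin (j + 1) → ℕ) :=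
    fun z => (fun i => z.1 i.succ, z.2) with hφ
  have hT : (expTuples N j ×ˢ expTuples N (j + 1)).card = L ^ (2 * (j + 1) - 1) := by
    rw [Finset.card_product, card_expTuples, card_expTuples, ← pow_add]
    congr 1
    omega
  rw [← hT]
  refine Finset.card_le_card_of_injOn φ (fun z hz => ?_) fun z hz z' hz' hzz => ?_
  · rw [Finset.mem_coe, Finset.mem_filter, Finset.mem_product] at hz
    simp only [hφ, Finset.coe_product, Set.mem_prod, Finset.mem_coe]
    exact ⟨mem_expTuples.mpr fun i => (mem_expTuples.mp hz.1.1) i.succ, hz.1.2⟩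
  · rw [Finset.mem_coe, Finset.mem_filter] at hz hz'
    simp only [hφ, Prod.mk.injEq] at hzz
    obtain ⟨htail, h2⟩ := hzz
    have e1 := hz.2
    have e2 := hz'.2
    rw [tupleSum_succ] at e1 e2
    rw [h2] at e1
    have e3 : (∑ i : Fin j, 2 ^ z'.1 i.succ) = ∑ i : Fin j, 2 ^ z.1 i.succ :=
      Finset.sum_congr rfl fun i _ => by rw [show z'.1 i.succ = z.1 i.succ from (congrFun htail i).symm]
    rw [e3] at e2
    have h0 : 2 ^ z.1 0 = 2 ^ z'.1 0 := Nat.add_right_cancel (e1.trans e2.symm)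
    exact Prod.ext (eq_of_apply_zero_eq_of_tail_eq (Nat.pow_right_injective le_rfl h0) htail) h2


/-! ### The weight `σ(m) = 2C₀ f(m)` on the pairs `m = ∑2^{ν_i} - ∑2^{μ_i}` -/

/-- `|∑ 2^{ν_i} - ∑ 2^{μ_i}|`, the argument of `σ` in `S(k, L)`. [cite: PintzRuzsa2003, §9 (9.1)] -/
def pairDiff {k : ℕ} (z : (Fin k → ℕ) × (Fin k → ℕ)) : ℕ := ((tupleSum z.1 : ℤ) - tupleSum z.2).natAbs

/-- `∑ 2^{ν_i}` is even when all `ν_i ≥ 1`. [folklore] -/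
theorem even_tupleSum {N k : ℕ} {ν : Fin k → ℕ} (hν : ν ∈ expTuples N k) : Even (tupleSum ν) := by
  unfold tupleSum
  refine Finset.even_sum _ fun i _ => ?_
  have h1 : 1 ≤ ν i := ((mem_expTuples.mp hν) i).1
  exact (Nat.even_pow' (by omega)).mpr even_two

/-- `m = ∑2^{ν_i} - ∑2^{μ_i}` is even. [folklore] -/
theorem even_pairDiff {N k : ℕ} {z : (Fin k → ℕ) × (Fin k → ℕ)}
    (hz : z ∈ expTuples N k ×ˢ expTuples N k) : Even (pairDiff z) := by
  rw [Finset.mem_product] at hz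
  unfold pairDiff
  rw [Int.natAbs_even, Int.even_sub]
  exact iff_of_true ((Int.even_coe_nat _).mpr (even_tupleSum hz.1))
    ((Int.even_coe_nat _).mpr (even_tupleSum hz.2))

/-- Off the diagonal, `m ≠ 0`. [folklore] -/
theorem pairDiff_ne_zero {N k : ℕ} {z : (Fin k → ℕ) × (Fin k → ℕ)} (hz : z ∈ offDiagPairs N k) :
    pairDiff z ≠ 0 := by
  unfold offDiagPairs at hz
  rw [Finset.mem_filter] at hz
  unfold pairDiff
  omega

/-- `∑ 2^{ν_i} ≤ k 2^L` on `[1, L]^k`. [folklore] -/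
theorem tupleSum_le {N k : ℕ} {ν : Fin k → ℕ} (hν : ν ∈ expTuples N k) :
    tupleSum ν ≤ k * 2 ^ powLen N := by
  unfold tupleSum
  calc ∑ i, 2 ^ ν i ≤ ∑ _i : Fin k, 2 ^ powLen N :=
        Finset.sum_le_sum fun i _ => Nat.pow_le_pow_right two_pos ((mem_expTuples.mp hν) i).2
    _ = k * 2 ^ powLen N := by rw [Finset.sum_const, Finset.card_univ, Fintype.card_fin, smul_eq_mul]

/-- `|m| ≤ k 2^L`. [folklore] -/
theorem pairDiff_le {N k : ℕ} {z : (Fin k → ℕ) × (Fin k → ℕ)} (hz : z ∈ expTuples N k ×ˢ expTuples N k) :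
    pairDiff z ≤ k * 2 ^ powLen N := by
  rw [Finset.mem_product] at hz
  have h1 := tupleSum_le hz.1
  have h2 := tupleSum_le hz.2
  unfold pairDiff
  omega

/-- `d ∣ |m|` iff `∑2^{ν_i} ≡ ∑2^{μ_i} (mod d)`. [folklore] -/
theorem dvd_pairDiff_iff {k : ℕ} (d : ℕ) (z : (Fin k → ℕ) × (Fin k → ℕ)) :
    d ∣ pairDiff z ↔ tupleSum z.1 % d = tupleSum z.2 % d := by
  unfold pairDiff
  rw [← Int.natCast_dvd, ← Nat.modEq_iff_dvd]
  exact ⟨fun h => h.symm, fun h => Nat.ModEq.symm h⟩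

/-- For even `n`, `𝔖(n) = 2C₀ f(n)` (`(p-1)/(p-2) = 1 + 1/(p-2)`). [cite: PintzRuzsa2003, §2 (2.7), (2.12)] -/
theorem goldbachSingularSeries_of_even {n : ℕ} (hn : Even n) :
    goldbachSingularSeries n = 2 * twinPrimeConst * fWeight n := by
  unfold goldbachSingularSeries fWeight
  rw [if_neg (Nat.not_odd_iff_even.mpr hn)]
  congr 1
  refine Finset.prod_congr rfl fun p hp => ?_
  have hp3 : (3 : ℝ) ≤ p := by exact_mod_cast (Finset.mem_filter.mp hp).2
  have : (p : ℝ) - 2 ≠ 0 := by linarith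
  field_simp
  ring

/-- **`S(k,L) = 2C₀ ∑_{(ν,μ), m ≠ 0} f(|m|)`.** [cite: PintzRuzsa2003, §9 (9.4)] -/
theorem pairSingularSum_eq (N k : ℕ) :
    pairSingularSum N k = 2 * twinPrimeConst * ∑ z ∈ offDiagPairs N k, fWeight (pairDiff z) := by
  unfold pairSingularSum
  rw [Finset.mul_sum]
  refine Finset.sum_congr rfl fun z hz => ?_
  have hz' : z ∈ expTuples N k ×ˢ expTuples N k := by
    unfold offDiagPairs at hz
    exact (Finset.mem_filter.mp hz).1
  exact goldbachSingularSeries_of_even (even_pairDiff hz')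

/-! ### Splitting `f(n)` by the order of `2` modulo its prime factors -/

/-- The odd prime factors `p` of `n` with `ϱ(p) ≤ Y`. [folklore] -/
def smallOrdFactors (Y n : ℕ) : Finset ℕ := (n.primeFactors.filter (2 < ·)).filter fun p => ordTwo p ≤ Y

/-- The odd prime factors `p` of `n` with `ϱ(p) > Y`. [folklore] -/
def largeOrdFactors (Y n : ℕ) : Finset ℕ :=
  (n.primeFactors.filter (2 < ·)).filter fun p => ¬ ordTwo p ≤ Y

/-- `f(n) = ∏_{p ∣ n, ϱ(p) ≤ Y} (1 + 1/(p-2)) · ∏_{p ∣ n, ϱ(p) > Y} (1 + 1/(p-2))`. [folklore] -/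
theorem fWeight_eq_mul (Y n : ℕ) :
    fWeight n = (∏ p ∈ smallOrdFactors Y n, (1 + 1 / ((p : ℝ) - 2))) *
      ∏ p ∈ largeOrdFactors Y n, (1 + 1 / ((p : ℝ) - 2)) := by
  unfold fWeight smallOrdFactors largeOrdFactors
  rw [Finset.prod_filter_mul_prod_filter_not]

/-- Membership in `smallOrdFactors`. [folklore] -/
theorem mem_smallOrdFactors {Y n p : ℕ} :
    p ∈ smallOrdFactors Y n ↔ p ∈ n.primeFactors ∧ 2 < p ∧ ordTwo p ≤ Y := by
  unfold smallOrdFactors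
  rw [Finset.mem_filter, Finset.mem_filter, and_assoc]

/-- `smallOrdFactors Y n ⊆ primesOrdLE Y`. [folklore] -/
theorem smallOrdFactors_subset (Y n : ℕ) : smallOrdFactors Y n ⊆ primesOrdLE Y := by
  intro p hp
  obtain ⟨hp0, hp2, hpY⟩ := mem_smallOrdFactors.mp hp
  have hpp := Nat.prime_of_mem_primeFactors hp0
  exact mem_primesOrdLE.mpr ⟨hpp, hpp.odd_of_ne_two (by omega), hpY⟩

/-- `1 ≤ 1 + 1/(p-2)` for `p ≥ 3`. [folklore] -/
theorem one_le_factor {p : ℕ} (hp : 2 < p) : (1 : ℝ) ≤ 1 + 1 / ((p : ℝ) - 2) := by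
  have : (3 : ℝ) ≤ p := by exact_mod_cast hp
  have : (0 : ℝ) < p - 2 := by linarith
  have : 0 ≤ 1 / ((p : ℝ) - 2) := by positivity
  linarith

/-- `1 ≤ ∏ (1 + 1/(p-2))` over primes `p ≥ 3`. [folklore] -/
theorem one_le_prod_factor {s : Finset ℕ} (hs : ∀ p ∈ s, 2 < p) :
    (1 : ℝ) ≤ ∏ p ∈ s, (1 + 1 / ((p : ℝ) - 2)) :=
  Finset.prod_induction _ (fun x : ℝ => 1 ≤ x) (fun _ _ ha hb => one_le_mul_of_one_le_of_one_le ha hb)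
    le_rfl fun p hp => one_le_factor (hs p hp)

/-- **Few prime factors of large order**: for `n ≠ 0`, `n ≤ B`, `Y ≥ 2`,
`∏_{p ∣ n, ϱ(p) > Y} (1 + 1/(p-2)) ≤ exp(log B / ((Y-1) log(Y+1)))` (each such `p` exceeds `Y`, so
there are at most `log B / log(Y+1)` of them, each factor being `≤ 1 + 1/(Y-1) ≤ e^{1/(Y-1)}`).
[folklore] -/
theorem prod_largeOrdFactors_le {Y n B : ℕ} (hY : 2 ≤ Y) (hn : n ≠ 0) (hnB : n ≤ B) :
    ∏ p ∈ largeOrdFactors Y n, (1 + 1 / ((p : ℝ) - 2)) ≤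
      Real.exp (Real.log B / (((Y : ℝ) - 1) * Real.log ((Y : ℝ) + 1))) := by
  set Q := largeOrdFactors Y n with hQ
  have hQ' : ∀ p ∈ Q, p.Prime ∧ Y + 1 ≤ p := by
    intro p hp
    rw [hQ] at hp
    unfold largeOrdFactors at hp
    rw [Finset.mem_filter, Finset.mem_filter] at hp
    obtain ⟨⟨hp0, -⟩, hpY⟩ := hp
    have hpp := Nat.prime_of_mem_primeFactors hp0
    have := ordTwo_le_self hpp.ne_zero
    exact ⟨hpp, by omega⟩
  have hY2 : (2 : ℝ) ≤ Y := by exact_mod_cast hY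
  have hY1 : (0 : ℝ) < (Y : ℝ) - 1 := by linarith
  have hlogY : 0 < Real.log ((Y : ℝ) + 1) := Real.log_pos (by linarith)
  have h1 : ∏ p ∈ Q, (1 + 1 / ((p : ℝ) - 2)) ≤ (1 + 1 / ((Y : ℝ) - 1)) ^ Q.card := by
    rw [← Finset.prod_const]
    refine Finset.prod_le_prod (fun p hp => ?_) fun p hp => ?_
    · have := (hQ' p hp).2
      exact zero_le_one.trans (one_le_factor (by omega))
    · have hp := (hQ' p hp).2
      have hp' : (Y : ℝ) + 1 ≤ p := by exact_mod_cast hp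
      have hle : (Y : ℝ) - 1 ≤ p - 2 := by linarith
      have := one_div_le_one_div_of_le hY1 hle
      linarith
  have h2 : (Y + 1) ^ Q.card ≤ B := by
    have hprod : ∏ p ∈ Q, p ∣ n := by
      have hsub : Q ⊆ n.primeFactors := fun p hp => by
        rw [hQ] at hp
        unfold largeOrdFactors at hp
        exact (Finset.mem_filter.mp (Finset.mem_filter.mp hp).1).1
      exact (Finset.prod_dvd_prod_of_subset _ _ _ hsub).trans (Nat.prod_primeFactors_dvd n)
    calc (Y + 1) ^ Q.card ≤ ∏ p ∈ Q, p := Finset.pow_card_le_prod Q (fun p => p) _ fun p hp => (hQ' p hp).2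
      _ ≤ n := Nat.le_of_dvd (Nat.pos_of_ne_zero hn) hprod
      _ ≤ B := hnB
  have hB1 : 1 ≤ B := (Nat.pos_of_ne_zero hn).trans_le hnB
  have h3 : (Q.card : ℝ) * Real.log ((Y : ℝ) + 1) ≤ Real.log B := by
    rw [← Real.log_pow]
    apply Real.log_le_log (by positivity)
    exact_mod_cast h2
  calc ∏ p ∈ Q, (1 + 1 / ((p : ℝ) - 2)) ≤ (1 + 1 / ((Y : ℝ) - 1)) ^ Q.card := h1
    _ ≤ Real.exp (1 / ((Y : ℝ) - 1)) ^ Q.card := by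
        have h0 : (0 : ℝ) ≤ 1 + 1 / ((Y : ℝ) - 1) := by
          have : 0 ≤ 1 / ((Y : ℝ) - 1) := (one_div_pos.mpr hY1).le
          linarith
        exact pow_le_pow_left₀ h0 (by linarith [Real.add_one_le_exp (1 / ((Y : ℝ) - 1))]) _
    _ = Real.exp (Q.card * (1 / ((Y : ℝ) - 1))) := (Real.exp_nat_mul _ _).symm
    _ ≤ Real.exp (Real.log B / (((Y : ℝ) - 1) * Real.log ((Y : ℝ) + 1))) := by
        apply Real.exp_le_exp.mpr
        rw [mul_one_div, div_le_div_iff₀ hY1 (mul_pos hY1 hlogY)]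
        calc (Q.card : ℝ) * ((Y - 1) * Real.log (Y + 1))
            = (Q.card * Real.log ((Y : ℝ) + 1)) * (Y - 1) := by ring
          _ ≤ Real.log B * ((Y : ℝ) - 1) := by gcongr

/-! ### Square-free products of odd primes -/

/-- `d_T = ∏_{p ∈ T} p`. [folklore] -/
def setProd (T : Finset ℕ) : ℕ := ∏ p ∈ T, p

/-- `d_T ≠ 0` for a set of primes. [folklore] -/
theorem setProd_ne_zero {T : Finset ℕ} (hT : ∀ p ∈ T, p.Prime) : setProd T ≠ 0 :=
  Finset.prod_ne_zero_iff.mpr fun p hp => (hT p hp).ne_zero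

/-- The prime factors of `d_T` are `T`. [folklore] -/
theorem primeFactors_setProd {T : Finset ℕ} (hT : ∀ p ∈ T, p.Prime) : (setProd T).primeFactors = T :=
  Nat.primeFactors_prod hT

/-- `d_T` is odd for a set of odd numbers. [folklore] -/
theorem odd_setProd {T : Finset ℕ} (hT : ∀ p ∈ T, Odd p) : Odd (setProd T) :=
  Finset.prod_induction _ Odd (fun _ _ ha hb => ha.mul hb) odd_one hT

/-- A product of distinct primes is square-free. [folklore] -/
theorem squarefree_setProd {T : Finset ℕ} (hT : ∀ p ∈ T, p.Prime) : Squarefree (setProd T) := by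
  classical
  unfold setProd
  induction T using Finset.induction_on with
  | empty => simp
  | insert p T hpT ih =>
      rw [Finset.prod_insert hpT]
      have hp : p.Prime := hT p (Finset.mem_insert_self p T)
      have hT' : ∀ q ∈ T, q.Prime := fun q hq => hT q (Finset.mem_insert_of_mem hq)
      have hcop : Nat.Coprime p (∏ q ∈ T, q) :=
        Nat.Coprime.prod_right fun q hq => (Nat.coprime_primes hp (hT' q hq)).mpr (by
          rintro rfl
          exact hpT hq)
      exact (Nat.squarefree_mul hcop).mpr ⟨hp.prime.squarefree, ih hT'⟩

/-- `κ(d_T) = ∏_{p ∈ T} 1/(p-2)` for a set `T` of odd primes. [cite: PintzRuzsa2003, §8 (8.10)] -/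
theorem kappa_setProd {T : Finset ℕ} (hT : ∀ p ∈ T, p.Prime ∧ Odd p) :
    kappa (setProd T) = ∏ p ∈ T, 1 / ((p : ℝ) - 2) := by
  rw [kappa_apply, if_pos ⟨odd_setProd fun p hp => (hT p hp).2,
    squarefree_setProd fun p hp => (hT p hp).1⟩]
  unfold kWeight
  rw [primeFactors_setProd fun p hp => (hT p hp).1]

/-- `T ↦ d_T` is injective on sets of primes. [folklore] -/
theorem setProd_injOn {P : Finset ℕ} (hP : ∀ p ∈ P, p.Prime) :
    Set.InjOn setProd (P.powerset : Set (Finset ℕ)) := by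
  intro T₁ h₁ T₂ h₂ h
  rw [Finset.mem_coe, Finset.mem_powerset] at h₁ h₂
  have e₁ := primeFactors_setProd fun p hp => hP p (h₁ hp)
  have e₂ := primeFactors_setProd fun p hp => hP p (h₂ hp)
  rw [← e₁, ← e₂, h]

/-- `d_T ∣ n` when `T ⊆ primeFactors n`. [folklore] -/
theorem setProd_dvd_of_subset {T : Finset ℕ} {n : ℕ} (h : T ⊆ n.primeFactors) : setProd T ∣ n :=
  (Finset.prod_dvd_prod_of_subset _ _ _ h).trans (Nat.prod_primeFactors_dvd n)

/-- `T ⊆ primeFactors n` when `d_T ∣ n ≠ 0` and `T` consists of primes. [folklore] -/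
theorem subset_primeFactors_of_setProd_dvd {T : Finset ℕ} {n : ℕ} (hT : ∀ p ∈ T, p.Prime)
    (hn : n ≠ 0) (h : setProd T ∣ n) : T ⊆ n.primeFactors := fun p hp =>
  Nat.mem_primeFactors.mpr ⟨hT p hp, (Finset.dvd_prod_of_mem _ hp).trans h, hn⟩

/-- The elements of `primesOrdLE x` are odd primes. [folklore] -/
theorem prime_odd_of_mem_powerset_primesOrdLE {x : ℕ} {T : Finset ℕ} (hT : T ∈ (primesOrdLE x).powerset) :
    ∀ p ∈ T, p.Prime ∧ Odd p := fun p hp => by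
  have := mem_primesOrdLE.mp (Finset.mem_powerset.mp hT hp)
  exact ⟨this.1, this.2.1⟩

/-- **The exchange of summations**: for subsets `Q z ⊆ P`,
`∑_z ∏_{p ∈ Q z} (1 + w p) = ∑_{T ⊆ P} (∏_{p∈T} w p) · #{z : T ⊆ Q z}`.
[cite: PintzRuzsa2003, §8 (8.10)–(8.11)] -/
theorem sum_prod_one_add_eq {ι : Type*} (s : Finset ι) (P : Finset ℕ) (Q : ι → Finset ℕ)
    (hQ : ∀ z ∈ s, Q z ⊆ P) (w : ℕ → ℝ) :
    ∑ z ∈ s, ∏ p ∈ Q z, (1 + w p) =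
      ∑ T ∈ P.powerset, (∏ p ∈ T, w p) * ((s.filter fun z => T ⊆ Q z).card : ℝ) := by
  classical
  calc ∑ z ∈ s, ∏ p ∈ Q z, (1 + w p)
      = ∑ z ∈ s, ∑ T ∈ (Q z).powerset, ∏ p ∈ T, w p :=
          Finset.sum_congr rfl fun z _ => Finset.prod_one_add _
    _ = ∑ z ∈ s, ∑ T ∈ P.powerset, if T ⊆ Q z then ∏ p ∈ T, w p else 0 := by
          refine Finset.sum_congr rfl fun z hz => ?_
          rw [← Finset.sum_filter]
          congr 1
          ext T
          simp only [Finset.mem_powerset, Finset.mem_filter]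
          exact ⟨fun h => ⟨h.trans (hQ z hz), h⟩, fun h => h.2⟩
    _ = ∑ T ∈ P.powerset, ∑ z ∈ s, if T ⊆ Q z then ∏ p ∈ T, w p else 0 := Finset.sum_comm
    _ = _ := by
          refine Finset.sum_congr rfl fun T _ => ?_
          rw [← Finset.sum_filter, Finset.sum_const, nsmul_eq_mul, mul_comm]

/-- `∑_{T ⊆ P} ∏_{p ∈ T} w p = ∏_{p ∈ P} (1 + w p)`. [folklore] -/
theorem sum_powerset_prod_eq (P : Finset ℕ) (w : ℕ → ℝ) :
    ∑ T ∈ P.powerset, ∏ p ∈ T, w p = ∏ p ∈ P, (1 + w p) := (Finset.prod_one_add P).symm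

/-- **`∏_{ϱ(p) ≤ x} (1 + 1/(p-2)) ≤ e¹⁴ log² x`** for `x ≥ 2` (`1/(p-2) ≤ 2/(p-1)`,
`1 + t ≤ eᵗ`, and `∑_{ϱ(p) ≤ x} 1/(p-1) ≤ log log x + 7`, `Romanov.sum_primesOrdLE_inv_pred_le`).
[cite: PintzRuzsa2003, §8 (8.13)–(8.14)] -/
theorem prod_one_add_inv_primesOrdLE_le {x : ℕ} (hx : 2 ≤ x) :
    ∏ p ∈ primesOrdLE x, (1 + 1 / ((p : ℝ) - 2)) ≤ Real.exp 14 * Real.log x ^ 2 := by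
  have hx2 : (2 : ℝ) ≤ x := by exact_mod_cast hx
  have hlogx0 : 0 < Real.log x := Real.log_pos (by linarith)
  set P := primesOrdLE x with hP
  have hP3 : ∀ p ∈ P, (3 : ℝ) ≤ p := fun p hp => by
    obtain ⟨hpp, hodd, -⟩ := mem_primesOrdLE.mp hp
    have hp2 : p ≠ 2 := by rintro rfl; exact (Nat.not_even_iff_odd.mpr hodd) even_two
    exact_mod_cast hpp.two_le.lt_of_ne (Ne.symm hp2)
  have hw : ∀ p ∈ P, 0 ≤ 1 / ((p : ℝ) - 2) := fun p hp => by
    have := hP3 p hp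
    have : (0 : ℝ) < p - 2 := by linarith
    positivity
  have h2 : ∏ p ∈ P, (1 + 1 / ((p : ℝ) - 2)) ≤ Real.exp (∑ p ∈ P, 2 * (1 / ((p : ℝ) - 1))) := by
    rw [Real.exp_sum]
    refine Finset.prod_le_prod (fun p hp => by linarith [hw p hp]) fun p hp => ?_
    have hp3 := hP3 p hp
    have hle : 1 / ((p : ℝ) - 2) ≤ 2 * (1 / ((p : ℝ) - 1)) := by
      rw [mul_one_div, div_le_div_iff₀ (by linarith) (by linarith)]
      linarith
    have := Real.add_one_le_exp (2 * (1 / ((p : ℝ) - 1)))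
    linarith
  have h3 : ∑ p ∈ P, 2 * (1 / ((p : ℝ) - 1)) ≤ 2 * (Real.log (Real.log x) + 7) := by
    rw [← Finset.mul_sum]
    exact mul_le_mul_of_nonneg_left (sum_primesOrdLE_inv_pred_le hx) (by norm_num)
  calc ∏ p ∈ P, (1 + 1 / ((p : ℝ) - 2)) ≤ Real.exp (∑ p ∈ P, 2 * (1 / ((p : ℝ) - 1))) := h2
    _ ≤ Real.exp (2 * (Real.log (Real.log x) + 7)) := Real.exp_le_exp.mpr h3
    _ = Real.exp 14 * Real.log x ^ 2 := by
        rw [show 2 * (Real.log (Real.log x) + 7) = (14 : ℝ) + ((2 : ℕ) : ℝ) * Real.log (Real.log x) by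
          push_cast; ring, Real.exp_add, Real.exp_nat_mul, Real.exp_log hlogx0]

/-! ### Summability of `∑ κ(d) P_d(k)` and the constant `A(k)` -/

/-- `0 ≤ κ(d) P_d(k) ≤ κ(d)/ϱ(d)` for `k ≥ 1`. [cite: PintzRuzsa2003, §9] -/
theorem kappa_mul_residueProb_le {k : ℕ} (hk : 1 ≤ k) (d : ℕ) :
    kappa d * residueProb d k ≤ kappa d / ordTwo d := by
  rw [kappa_apply]
  split_ifs with h
  · rw [div_eq_mul_one_div]
    exact mul_le_mul_of_nonneg_left (residueProb_le_inv h.1 hk) (kWeight_nonneg h.1)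
  · rw [zero_mul, zero_div]

/-- `0 ≤ κ(d) P_d(k)`. [folklore] -/
theorem kappa_mul_residueProb_nonneg (d k : ℕ) : 0 ≤ kappa d * residueProb d k :=
  mul_nonneg (kappa_nonneg d) (residueProb_nonneg d k)

/-- **The series `∑_d κ(d) P_d(k)` converges** for `k ≥ 1` (dominated by Romanov's series
`∑ κ(d)/ϱ(d) = R₀`). [cite: PintzRuzsa2003, §8 (8.14), §9 Theorem 4] -/
theorem summable_kappa_mul_residueProb {k : ℕ} (hk : 1 ≤ k) :
    Summable fun d : ℕ => kappa d * residueProb d k :=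
  Summable.of_nonneg_of_le (kappa_mul_residueProb_nonneg · k) (kappa_mul_residueProb_le hk)
    summable_kappa_div_ordTwo

/-- **Pintz–Ruzsa's `A(k)`** (Theorem 4, (9.7); Khalfalah–Pintz), as the explicit series
`A(k) = C₀ ∑'_{d odd, square-free} k(d) P_d(k) - 1`, `P_d(k)` the local density `residueProb d k`
(`C₀ = Literature.NumberTheory.Sieve.twinPrimeConst`). That this series IS the limit in (9.7) is
`tendsto_pairSingularSum_div` below; the numerical values (9.10) (`0.003 < A(4) < 0.004`, …) are a
computation of Khalfalah–Pintz and are NOT asserted in this file. [cite: PintzRuzsa2003, §9 Theorem 4 (9.7)] -/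
def aConst (k : ℕ) : ℝ := twinPrimeConst * (∑' d : ℕ, kappa d * residueProb d k) - 1

/-- Finite sums over prime sets are below the series: `∑_{T ⊆ P} κ(d_T) P_{d_T}(k) ≤ ∑' κ P`.
[folklore] -/
theorem sum_powerset_kappa_mul_residueProb_le {k : ℕ} (hk : 1 ≤ k) {P : Finset ℕ}
    (hP : ∀ p ∈ P, p.Prime) :
    ∑ T ∈ P.powerset, kappa (setProd T) * residueProb (setProd T) k ≤
      ∑' d : ℕ, kappa d * residueProb d k := by
  classical
  rw [← Finset.sum_image (f := fun d => kappa d * residueProb d k) (setProd_injOn hP)]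
  exact (summable_kappa_mul_residueProb hk).sum_le_tsum _ fun d _ => kappa_mul_residueProb_nonneg d k

/-- The tail bound: for prime sets `T ⊆ P` with `ϱ(d_T) > Z`,
`∑ κ(d_T)/ϱ(d_T) ≤ R₀ - ∑_{d ≤ Z} κ(d)/ϱ(d)` (all these `d_T` exceed `Z`). [cite: PintzRuzsa2003, §8 (8.14)] -/
theorem sum_filter_kappa_div_le_tail {P : Finset ℕ} (hP : ∀ p ∈ P, p.Prime) (Z : ℕ) :
    ∑ T ∈ P.powerset.filter (fun T => ¬ ordTwo (setProd T) ≤ Z), kappa (setProd T) / ordTwo (setProd T) ≤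
      romanovConstPR - ∑ d ∈ range (Z + 1), kappa d / ordTwo d := by
  classical
  set F := P.powerset.filter (fun T => ¬ ordTwo (setProd T) ≤ Z) with hF
  have hinj : Set.InjOn setProd (F : Set (Finset ℕ)) := fun T₁ h₁ T₂ h₂ h =>
    setProd_injOn hP (Finset.mem_of_mem_filter _ h₁) (Finset.mem_of_mem_filter _ h₂) h
  rw [← Finset.sum_image (f := fun d => kappa d / ordTwo d) hinj]
  have hdisj : Disjoint (range (Z + 1)) (F.image setProd) := by
    rw [Finset.disjoint_left]
    intro d hd hd'
    rw [Finset.mem_range] at hd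
    obtain ⟨T, hT, rfl⟩ := Finset.mem_image.mp hd'
    rw [hF, Finset.mem_filter] at hT
    have h0 : setProd T ≠ 0 := setProd_ne_zero fun p hp => hP p (Finset.mem_powerset.mp hT.1 hp)
    have := ordTwo_le_self h0
    omega
  have := sum_kappa_div_ordTwo_le_romanovConstPR (range (Z + 1) ∪ F.image setProd)
  rw [Finset.sum_union hdisj] at this
  linarith


/-! ### The upper bound for `S(k, L)` at a fixed `N` -/

/-- The factor `exp(log(k 2^L) / ((L-1) log(L+1)))` bounding `∏_{p ∣ m, ϱ(p) > L} (1 + 1/(p-2))`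
uniformly over the `m = ∑2^{ν_i} - ∑2^{μ_i} ≠ 0` (`prod_largeOrdFactors_le`); it tends to `1`.
[folklore] -/
def largeOrdBound (k L : ℕ) : ℝ :=
  Real.exp (Real.log ((k * 2 ^ L : ℕ) : ℝ) / (((L : ℝ) - 1) * Real.log ((L : ℝ) + 1)))

/-- **Step 1**: `∑_{m ≠ 0} f(|m|) ≤ largeOrdBound · ∑_{m ≠ 0} ∏_{p ∣ m, p > 2, ϱ(p) ≤ L} (1 + 1/(p-2))`.
[cite: PintzRuzsa2003, §9 (9.4)] -/
theorem sum_fWeight_le_smallOrd (N k : ℕ) (hL : 2 ≤ powLen N) :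
    ∑ z ∈ offDiagPairs N k, fWeight (pairDiff z) ≤ largeOrdBound k (powLen N) *
      ∑ z ∈ offDiagPairs N k, ∏ p ∈ smallOrdFactors (powLen N) (pairDiff z), (1 + 1 / ((p : ℝ) - 2)) := by
  rw [Finset.mul_sum]
  refine Finset.sum_le_sum fun z hz => ?_
  have hzP : z ∈ expTuples N k ×ˢ expTuples N k := by
    unfold offDiagPairs at hz
    exact (Finset.mem_filter.mp hz).1
  rw [fWeight_eq_mul (powLen N) (pairDiff z), mul_comm]
  refine mul_le_mul_of_nonneg_right ?_
    (zero_le_one.trans (one_le_prod_factor fun p hp => (mem_smallOrdFactors.mp hp).2.1))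
  exact prod_largeOrdFactors_le hL (pairDiff_ne_zero hz) (pairDiff_le hzP)

/-- **Steps 2–4**: with `P_L` the odd primes of order `≤ L` and any `Z`,
`∑_{m ≠ 0} ∏_{p ∣ m, ϱ(p) ≤ L} (1 + k(p)) = ∑_{T ⊆ P_L} k(d_T) #{m ≠ 0 : d_T ∣ m}`
`≤ (L+Z)^{2k} ∑' κ P + L^{2k} (R₀ - ∑_{d ≤ Z} κ/ϱ) + L^{2k-1} e¹⁴ log² L`
(terms with `ϱ(d_T) ≤ Z` through the residue count, the others through the crude count).
[cite: PintzRuzsa2003, §9 (9.4), Theorem 4] -/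
theorem sum_smallOrd_le {k : ℕ} (hk : 1 ≤ k) (N Z : ℕ) (hL : 2 ≤ powLen N) :
    ∑ z ∈ offDiagPairs N k, ∏ p ∈ smallOrdFactors (powLen N) (pairDiff z), (1 + 1 / ((p : ℝ) - 2)) ≤
      ((powLen N : ℝ) + Z) ^ (2 * k) * (∑' d : ℕ, kappa d * residueProb d k) +
        (powLen N : ℝ) ^ (2 * k) * (romanovConstPR - ∑ d ∈ range (Z + 1), kappa d / ordTwo d) +
        (powLen N : ℝ) ^ (2 * k - 1) * (Real.exp 14 * Real.log (powLen N) ^ 2) := by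
  classical
  set L := powLen N with hLdef
  set P := primesOrdLE L with hP
  have hPpr : ∀ p ∈ P, p.Prime := fun p hp => (mem_primesOrdLE.mp hp).1
  have hex : ∑ z ∈ offDiagPairs N k, ∏ p ∈ smallOrdFactors L (pairDiff z), (1 + 1 / ((p : ℝ) - 2)) =
      ∑ T ∈ P.powerset, (∏ p ∈ T, 1 / ((p : ℝ) - 2)) *
        (((offDiagPairs N k).filter fun z => T ⊆ smallOrdFactors L (pairDiff z)).card : ℝ) :=
    sum_prod_one_add_eq _ _ _ (fun z _ => smallOrdFactors_subset L _) _
  rw [hex]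
  have hterm : ∀ T ∈ P.powerset, (∏ p ∈ T, 1 / ((p : ℝ) - 2)) *
      (((offDiagPairs N k).filter fun z => T ⊆ smallOrdFactors L (pairDiff z)).card : ℝ) ≤
      if ordTwo (setProd T) ≤ Z then
        kappa (setProd T) * residueProb (setProd T) k * ((L : ℝ) + Z) ^ (2 * k)
      else (L : ℝ) ^ (2 * k) * (kappa (setProd T) / ordTwo (setProd T)) +
        (L : ℝ) ^ (2 * k - 1) * kappa (setProd T) := by
    intro T hT
    have hTpo := prime_odd_of_mem_powerset_primesOrdLE hT
    have hkap : (∏ p ∈ T, 1 / ((p : ℝ) - 2)) = kappa (setProd T) := (kappa_setProd hTpo).symm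
    have hkap0 : 0 ≤ kappa (setProd T) := kappa_nonneg _
    have hodd : Odd (setProd T) := odd_setProd fun p hp => (hTpo p hp).2
    have hρ := ordTwo_pos hodd
    have hsub : ((offDiagPairs N k).filter fun z => T ⊆ smallOrdFactors L (pairDiff z)) ⊆
        congrPairs N k (setProd T) := by
      intro z hz
      rw [Finset.mem_filter] at hz
      obtain ⟨hzO, hzT⟩ := hz
      have hzP : z ∈ expTuples N k ×ˢ expTuples N k := by
        unfold offDiagPairs at hzO
        exact (Finset.mem_filter.mp hzO).1
      rw [mem_congrPairs]
      refine ⟨(Finset.mem_product.mp hzP).1, (Finset.mem_product.mp hzP).2, ?_⟩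
      rw [← dvd_pairDiff_iff]
      exact setProd_dvd_of_subset (hzT.trans fun p hp => (mem_smallOrdFactors.mp hp).1)
    have hcount : (((offDiagPairs N k).filter fun z => T ⊆ smallOrdFactors L (pairDiff z)).card : ℝ) ≤
        (congrPairs N k (setProd T)).card := by
      exact_mod_cast Finset.card_le_card hsub
    rw [hkap]
    split_ifs with hZ
    · have h1 : ((congrPairs N k (setProd T)).card : ℝ) ≤
          (residueSolutions (setProd T) k).card * ((L / ordTwo (setProd T) + 1 : ℕ) : ℝ) ^ (2 * k) := by
        exact_mod_cast card_congrPairs_le (N := N) (k := k) hodd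
      have h2 : ((residueSolutions (setProd T) k).card : ℝ) =
          residueProb (setProd T) k * (ordTwo (setProd T) : ℝ) ^ (2 * k) := by
        unfold residueProb
        rw [div_mul_cancel₀]
        exact pow_ne_zero _ (by exact_mod_cast hρ.ne')
      have h3 : (ordTwo (setProd T) : ℝ) * ((L / ordTwo (setProd T) + 1 : ℕ) : ℝ) ≤ (L : ℝ) + Z := by
        have h' : ordTwo (setProd T) * (L / ordTwo (setProd T) + 1) ≤ L + Z := by
          have := Nat.mul_div_le L (ordTwo (setProd T))
          rw [Nat.mul_add_one]
          linarith
        exact_mod_cast h'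
      calc kappa (setProd T) * _ ≤ kappa (setProd T) *
            ((residueSolutions (setProd T) k).card * ((L / ordTwo (setProd T) + 1 : ℕ) : ℝ) ^ (2 * k)) :=
            mul_le_mul_of_nonneg_left (hcount.trans h1) hkap0
        _ = kappa (setProd T) * residueProb (setProd T) k *
            ((ordTwo (setProd T) : ℝ) * ((L / ordTwo (setProd T) + 1 : ℕ) : ℝ)) ^ (2 * k) := by
            rw [h2, mul_pow]; ring
        _ ≤ kappa (setProd T) * residueProb (setProd T) k * ((L : ℝ) + Z) ^ (2 * k) := by
            apply mul_le_mul_of_nonneg_left _ (mul_nonneg hkap0 (residueProb_nonneg _ k))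
            exact pow_le_pow_left₀ (by positivity) h3 _
    · have h1 : ((congrPairs N k (setProd T)).card : ℝ) ≤
          (L : ℝ) ^ (2 * k - 1) * (((L / ordTwo (setProd T) : ℕ) : ℝ) + 1) := by
        exact_mod_cast card_congrPairs_le_crude (N := N) hodd hk
      have h2 : ((L / ordTwo (setProd T) : ℕ) : ℝ) ≤ (L : ℝ) / ordTwo (setProd T) := Nat.cast_div_le
      have hLpow : (L : ℝ) ^ (2 * k - 1) * L = (L : ℝ) ^ (2 * k) := by
        rw [← pow_succ]
        congr 1
        omega
      calc kappa (setProd T) * _ ≤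
          kappa (setProd T) * ((L : ℝ) ^ (2 * k - 1) * (((L / ordTwo (setProd T) : ℕ) : ℝ) + 1)) :=
            mul_le_mul_of_nonneg_left (hcount.trans h1) hkap0
        _ ≤ kappa (setProd T) * ((L : ℝ) ^ (2 * k - 1) * ((L : ℝ) / ordTwo (setProd T) + 1)) := by
            gcongr
        _ = (L : ℝ) ^ (2 * k) * (kappa (setProd T) / ordTwo (setProd T)) +
            (L : ℝ) ^ (2 * k - 1) * kappa (setProd T) := by
            rw [← hLpow]
            ring
  refine (Finset.sum_le_sum hterm).trans ?_
  rw [Finset.sum_ite]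
  have ha : ∑ T ∈ P.powerset.filter (fun T => ordTwo (setProd T) ≤ Z),
      kappa (setProd T) * residueProb (setProd T) k * ((L : ℝ) + Z) ^ (2 * k) ≤
      ((L : ℝ) + Z) ^ (2 * k) * ∑' d : ℕ, kappa d * residueProb d k := by
    rw [← Finset.sum_mul, mul_comm]
    apply mul_le_mul_of_nonneg_left _ (by positivity)
    calc ∑ T ∈ P.powerset.filter (fun T => ordTwo (setProd T) ≤ Z),
          kappa (setProd T) * residueProb (setProd T) k
        ≤ ∑ T ∈ P.powerset, kappa (setProd T) * residueProb (setProd T) k :=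
          Finset.sum_le_sum_of_subset_of_nonneg (Finset.filter_subset _ _)
            fun T _ _ => kappa_mul_residueProb_nonneg _ _
      _ ≤ _ := sum_powerset_kappa_mul_residueProb_le hk hPpr
  have hb : ∑ T ∈ P.powerset.filter (fun T => ¬ ordTwo (setProd T) ≤ Z),
      ((L : ℝ) ^ (2 * k) * (kappa (setProd T) / ordTwo (setProd T)) +
        (L : ℝ) ^ (2 * k - 1) * kappa (setProd T)) ≤
      (L : ℝ) ^ (2 * k) * (romanovConstPR - ∑ d ∈ range (Z + 1), kappa d / ordTwo d) +
        (L : ℝ) ^ (2 * k - 1) * (Real.exp 14 * Real.log L ^ 2) := by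
    rw [Finset.sum_add_distrib, ← Finset.mul_sum, ← Finset.mul_sum]
    refine add_le_add (mul_le_mul_of_nonneg_left (sum_filter_kappa_div_le_tail hPpr Z) (by positivity))
      (mul_le_mul_of_nonneg_left ?_ (by positivity))
    calc ∑ T ∈ P.powerset.filter (fun T => ¬ ordTwo (setProd T) ≤ Z), kappa (setProd T)
        ≤ ∑ T ∈ P.powerset, kappa (setProd T) :=
          Finset.sum_le_sum_of_subset_of_nonneg (Finset.filter_subset _ _) fun T _ _ => kappa_nonneg _
      _ = ∑ T ∈ P.powerset, ∏ p ∈ T, 1 / ((p : ℝ) - 2) :=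
          Finset.sum_congr rfl fun T hT => kappa_setProd (prime_odd_of_mem_powerset_primesOrdLE hT)
      _ = ∏ p ∈ P, (1 + 1 / ((p : ℝ) - 2)) := sum_powerset_prod_eq P _
      _ ≤ Real.exp 14 * Real.log L ^ 2 := prod_one_add_inv_primesOrdLE_le hL
  linarith [ha, hb]

/-- **`S(k, L)` at a fixed `N`, from above**: for `L = [log₂ N] ≥ 2` and every `Z`,
`S(k,L) ≤ 2C₀ · largeOrdBound k L · ((L+Z)^{2k} ∑' κ P + L^{2k}(R₀ - ∑_{d ≤ Z} κ/ϱ) + L^{2k-1} e¹⁴ log² L)`.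
[cite: PintzRuzsa2003, §9 (9.4), Theorem 4] -/
theorem pairSingularSum_le_fixed {k : ℕ} (hk : 1 ≤ k) (N Z : ℕ) (hL : 2 ≤ powLen N) :
    pairSingularSum N k ≤ 2 * twinPrimeConst * largeOrdBound k (powLen N) *
      (((powLen N : ℝ) + Z) ^ (2 * k) * (∑' d : ℕ, kappa d * residueProb d k) +
        (powLen N : ℝ) ^ (2 * k) * (romanovConstPR - ∑ d ∈ range (Z + 1), kappa d / ordTwo d) +
        (powLen N : ℝ) ^ (2 * k - 1) * (Real.exp 14 * Real.log (powLen N) ^ 2)) := by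
  have hC : 0 ≤ 2 * twinPrimeConst := by linarith [half_le_twinPrimeConst]
  have hδ : 0 ≤ largeOrdBound k (powLen N) := (Real.exp_pos _).le
  rw [pairSingularSum_eq, mul_assoc (2 * twinPrimeConst)]
  refine mul_le_mul_of_nonneg_left ?_ hC
  exact (sum_fWeight_le_smallOrd N k hL).trans (mul_le_mul_of_nonneg_left (sum_smallOrd_le hk N Z hL) hδ)

/-! ### The lower bound for `S(k, L)` at a fixed `N` -/

/-- **`S(k, L)` at a fixed `N`, from below**: for the odd primes `P₀` of order `≤ Y₀` and a bound
`M₀ ≤ L` for the orders `ϱ(d_T)`, `T ⊆ P₀`,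
`2C₀ ((L - M₀)^{2k} ∑_{T ⊆ P₀} κ(d_T) P_{d_T}(k) - L^{2k-1} ∏_{p ∈ P₀} (1 + k(p))) ≤ S(k, L)`
(`f(m) ≥ ∏_{p ∣ m, p ∈ P₀} (1 + k(p))`, the pairs with `d_T ∣ m ≠ 0` number at least
`#{d_T ∣ m} - r_{k,k}(0)`, and the residue count from below). [cite: PintzRuzsa2003, §9 (9.4), Theorem 4] -/
theorem pairSingularSum_ge_fixed {k : ℕ} (hk : 1 ≤ k) (N Y₀ M₀ : ℕ) (hM₀L : M₀ ≤ powLen N)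
    (hM : ∀ T ∈ (primesOrdLE Y₀).powerset, ordTwo (setProd T) ≤ M₀) :
    2 * twinPrimeConst *
      (((powLen N : ℝ) - M₀) ^ (2 * k) *
          (∑ T ∈ (primesOrdLE Y₀).powerset, kappa (setProd T) * residueProb (setProd T) k) -
        (powLen N : ℝ) ^ (2 * k - 1) * ∏ p ∈ primesOrdLE Y₀, (1 + 1 / ((p : ℝ) - 2))) ≤
      pairSingularSum N k := by
  classical
  set L := powLen N with hLdef
  set P := primesOrdLE Y₀ with hP
  have hC : 0 ≤ 2 * twinPrimeConst := by linarith [half_le_twinPrimeConst]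
  rw [pairSingularSum_eq]
  refine mul_le_mul_of_nonneg_left ?_ hC
  set Q₀ : ((Fin k → ℕ) × (Fin k → ℕ)) → Finset ℕ :=
    fun z => (((pairDiff z).primeFactors.filter (2 < ·)).filter fun p => p ∈ P) with hQ₀
  have hQ₀P : ∀ z ∈ offDiagPairs N k, Q₀ z ⊆ P := fun z _ p hp => (Finset.mem_filter.mp hp).2
  have hlow : ∑ z ∈ offDiagPairs N k, ∏ p ∈ Q₀ z, (1 + 1 / ((p : ℝ) - 2)) ≤
      ∑ z ∈ offDiagPairs N k, fWeight (pairDiff z) := by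
    refine Finset.sum_le_sum fun z _ => ?_
    unfold fWeight
    rw [← Finset.prod_filter_mul_prod_filter_not ((pairDiff z).primeFactors.filter (2 < ·)) (fun p => p ∈ P)]
    have h1 : (1 : ℝ) ≤ ∏ p ∈ ((pairDiff z).primeFactors.filter (2 < ·)).filter (fun p => ¬ p ∈ P),
        (1 + 1 / ((p : ℝ) - 2)) :=
      one_le_prod_factor fun p hp => (Finset.mem_filter.mp (Finset.mem_filter.mp hp).1).2
    have h0 : (0 : ℝ) ≤ ∏ p ∈ Q₀ z, (1 + 1 / ((p : ℝ) - 2)) :=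
      zero_le_one.trans (one_le_prod_factor fun p hp => (Finset.mem_filter.mp (Finset.mem_filter.mp hp).1).2)
    calc ∏ p ∈ Q₀ z, (1 + 1 / ((p : ℝ) - 2)) = (∏ p ∈ Q₀ z, (1 + 1 / ((p : ℝ) - 2))) * 1 := (mul_one _).symm
      _ ≤ _ := mul_le_mul_of_nonneg_left h1 h0
  refine le_trans ?_ hlow
  have hex : ∑ z ∈ offDiagPairs N k, ∏ p ∈ Q₀ z, (1 + 1 / ((p : ℝ) - 2)) =
      ∑ T ∈ P.powerset, (∏ p ∈ T, 1 / ((p : ℝ) - 2)) *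
        (((offDiagPairs N k).filter fun z => T ⊆ Q₀ z).card : ℝ) :=
    sum_prod_one_add_eq _ _ _ hQ₀P _
  rw [hex]
  have hterm : ∀ T ∈ P.powerset,
      kappa (setProd T) * (residueProb (setProd T) k * ((L : ℝ) - M₀) ^ (2 * k)) -
          (L : ℝ) ^ (2 * k - 1) * kappa (setProd T) ≤
        (∏ p ∈ T, 1 / ((p : ℝ) - 2)) * (((offDiagPairs N k).filter fun z => T ⊆ Q₀ z).card : ℝ) := by
    intro T hT
    have hTpo := prime_odd_of_mem_powerset_primesOrdLE hT
    have hkap : (∏ p ∈ T, 1 / ((p : ℝ) - 2)) = kappa (setProd T) := (kappa_setProd hTpo).symm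
    have hkap0 : 0 ≤ kappa (setProd T) := kappa_nonneg _
    have hodd : Odd (setProd T) := odd_setProd fun p hp => (hTpo p hp).2
    have hρ := ordTwo_pos hodd
    have hρM : ordTwo (setProd T) ≤ M₀ := hM T hT
    rw [hkap]
    have hcnt : (congrPairs N k (setProd T)).card ≤
        ((offDiagPairs N k).filter fun z => T ⊆ Q₀ z).card + coincidences N k := by
      unfold coincidences
      refine (Finset.card_le_card fun z hz => ?_).trans (Finset.card_union_le _ _)
      rw [Finset.mem_union, Finset.mem_filter, Finset.mem_filter]
      obtain ⟨hz1, hz2, hzc⟩ := mem_congrPairs.mp hz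
      have hzP : z ∈ expTuples N k ×ˢ expTuples N k := Finset.mem_product.mpr ⟨hz1, hz2⟩
      by_cases heq : tupleSum z.1 = tupleSum z.2
      · exact Or.inr ⟨hzP, heq⟩
      · left
        have hzO : z ∈ offDiagPairs N k := by
          unfold offDiagPairs
          exact Finset.mem_filter.mpr ⟨hzP, heq⟩
        refine ⟨hzO, fun p hp => ?_⟩
        have hdvd : setProd T ∣ pairDiff z := (dvd_pairDiff_iff (setProd T) z).mpr hzc
        have hsub := subset_primeFactors_of_setProd_dvd (fun p hp => (hTpo p hp).1)
          (pairDiff_ne_zero hzO) hdvd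
        have hp3 : 2 < p := by
          have h2le := (hTpo p hp).1.two_le
          have hp2 : p ≠ 2 := by
            rintro rfl
            exact (Nat.not_even_iff_odd.mpr (hTpo 2 hp).2) even_two
          omega
        simp only [hQ₀, Finset.mem_filter]
        exact ⟨⟨hsub hp, hp3⟩, Finset.mem_powerset.mp hT hp⟩
    have hcntR : ((congrPairs N k (setProd T)).card : ℝ) - (L : ℝ) ^ (2 * k - 1) ≤
        ((offDiagPairs N k).filter fun z => T ⊆ Q₀ z).card := by
      have h1 : ((congrPairs N k (setProd T)).card : ℝ) ≤
          ((offDiagPairs N k).filter fun z => T ⊆ Q₀ z).card + (coincidences N k : ℝ) := by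
        exact_mod_cast hcnt
      have h2 : (coincidences N k : ℝ) ≤ (L : ℝ) ^ (2 * k - 1) := by
        exact_mod_cast coincidences_le_pow (N := N) hk
      linarith
    have hlowc : residueProb (setProd T) k * ((L : ℝ) - M₀) ^ (2 * k) ≤ (congrPairs N k (setProd T)).card := by
      have h1 : ((residueSolutions (setProd T) k).card : ℝ) * (((L / ordTwo (setProd T) : ℕ) : ℝ)) ^ (2 * k) ≤
          (congrPairs N k (setProd T)).card := by
        exact_mod_cast le_card_congrPairs (N := N) (k := k) hodd
      have h2 : ((residueSolutions (setProd T) k).card : ℝ) =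
          residueProb (setProd T) k * (ordTwo (setProd T) : ℝ) ^ (2 * k) := by
        unfold residueProb
        rw [div_mul_cancel₀]
        exact pow_ne_zero _ (by exact_mod_cast hρ.ne')
      have h3 : (L : ℝ) - M₀ ≤ (ordTwo (setProd T) : ℝ) * ((L / ordTwo (setProd T) : ℕ) : ℝ) := by
        have h' := Nat.lt_mul_div_succ L hρ
        rw [Nat.mul_add_one] at h'
        have h'' : (L : ℝ) < (ordTwo (setProd T) : ℝ) * ((L / ordTwo (setProd T) : ℕ) : ℝ) +
            ordTwo (setProd T) := by exact_mod_cast h'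
        have hρM' : (ordTwo (setProd T) : ℝ) ≤ M₀ := by exact_mod_cast hρM
        linarith
      have h4 : (0 : ℝ) ≤ (L : ℝ) - M₀ := by
        have : (M₀ : ℝ) ≤ L := by exact_mod_cast hM₀L
        linarith
      calc residueProb (setProd T) k * ((L : ℝ) - M₀) ^ (2 * k)
          ≤ residueProb (setProd T) k *
            ((ordTwo (setProd T) : ℝ) * ((L / ordTwo (setProd T) : ℕ) : ℝ)) ^ (2 * k) :=
            mul_le_mul_of_nonneg_left (pow_le_pow_left₀ h4 h3 _) (residueProb_nonneg _ k)
        _ = ((residueSolutions (setProd T) k).card : ℝ) * (((L / ordTwo (setProd T) : ℕ) : ℝ)) ^ (2 * k) := by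
            rw [h2, mul_pow]; ring
        _ ≤ _ := h1
    calc kappa (setProd T) * (residueProb (setProd T) k * ((L : ℝ) - M₀) ^ (2 * k)) -
          (L : ℝ) ^ (2 * k - 1) * kappa (setProd T)
        ≤ kappa (setProd T) * (congrPairs N k (setProd T)).card - (L : ℝ) ^ (2 * k - 1) * kappa (setProd T) :=
          sub_le_sub_right (mul_le_mul_of_nonneg_left hlowc hkap0) _
      _ = kappa (setProd T) * (((congrPairs N k (setProd T)).card : ℝ) - (L : ℝ) ^ (2 * k - 1)) := by ring
      _ ≤ kappa (setProd T) * (((offDiagPairs N k).filter fun z => T ⊆ Q₀ z).card : ℝ) :=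
          mul_le_mul_of_nonneg_left hcntR hkap0
  calc ((L : ℝ) - M₀) ^ (2 * k) * (∑ T ∈ P.powerset, kappa (setProd T) * residueProb (setProd T) k) -
        (L : ℝ) ^ (2 * k - 1) * ∏ p ∈ P, (1 + 1 / ((p : ℝ) - 2))
      = ∑ T ∈ P.powerset, (kappa (setProd T) * (residueProb (setProd T) k * ((L : ℝ) - M₀) ^ (2 * k)) -
          (L : ℝ) ^ (2 * k - 1) * kappa (setProd T)) := by
        rw [Finset.sum_sub_distrib, ← sum_powerset_prod_eq, Finset.mul_sum, Finset.mul_sum]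
        congr 1
        · exact Finset.sum_congr rfl fun T _ => by ring
        · exact Finset.sum_congr rfl fun T hT => by
            rw [kappa_setProd (prime_odd_of_mem_powerset_primesOrdLE hT)]
    _ ≤ _ := Finset.sum_le_sum hterm


/-! ### Limits in `L` -/

/-- `L = [log₂ N] → ∞`. [folklore] -/
theorem tendsto_powLen : Tendsto powLen atTop atTop := by
  refine tendsto_atTop_atTop.mpr fun b => ⟨2 ^ b, fun N hN => ?_⟩
  unfold powLen
  exact Nat.le_log_of_pow_le one_lt_two hN

/-- `(1 + Z/L)^n → 1`. [folklore] -/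
theorem tendsto_one_add_div_pow (Z n : ℕ) :
    Tendsto (fun L : ℕ => (1 + (Z : ℝ) / L) ^ n) atTop (𝓝 1) := by
  have h : Tendsto (fun L : ℕ => (Z : ℝ) / L) atTop (𝓝 0) :=
    tendsto_const_nhds.div_atTop tendsto_natCast_atTop_atTop
  simpa using (h.const_add 1).pow n

/-- `(1 - M/L)^n → 1`. [folklore] -/
theorem tendsto_one_sub_div_pow (M n : ℕ) :
    Tendsto (fun L : ℕ => (1 - (M : ℝ) / L) ^ n) atTop (𝓝 1) := by
  have h : Tendsto (fun L : ℕ => (M : ℝ) / L) atTop (𝓝 0) :=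
    tendsto_const_nhds.div_atTop tendsto_natCast_atTop_atTop
  simpa using (h.const_sub 1).pow n

/-- `K/L → 0`. [folklore] -/
theorem tendsto_const_div_natCast (K : ℝ) : Tendsto (fun L : ℕ => K / L) atTop (𝓝 0) :=
  tendsto_const_nhds.div_atTop tendsto_natCast_atTop_atTop

/-- `E log² L / L → 0`. [folklore] -/
theorem tendsto_log_sq_div (E : ℝ) : Tendsto (fun L : ℕ => E * Real.log L ^ 2 / L) atTop (𝓝 0) := by
  have h := (Real.tendsto_pow_log_div_mul_add_atTop 1 0 2 one_ne_zero).comp tendsto_natCast_atTop_atTop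
  have h2 := h.const_mul E
  rw [mul_zero] at h2
  refine h2.congr fun L => ?_
  simp only [Function.comp_apply, one_mul, add_zero]
  ring

/-- `largeOrdBound k L → 1` (its exponent is `≤ (log k + 2)/log(L+1)` for `L ≥ 2`). [folklore] -/
theorem tendsto_largeOrdBound (k : ℕ) : Tendsto (fun L : ℕ => largeOrdBound k L) atTop (𝓝 1) := by
  have hexp : Tendsto (fun L : ℕ => Real.log ((k * 2 ^ L : ℕ) : ℝ) /
      (((L : ℝ) - 1) * Real.log ((L : ℝ) + 1))) atTop (𝓝 0) := by
    have hup : Tendsto (fun L : ℕ => (Real.log k + 2) / Real.log ((L : ℝ) + 1)) atTop (𝓝 0) := by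
      refine tendsto_const_nhds.div_atTop ?_
      exact Real.tendsto_log_atTop.comp (tendsto_atTop_add_const_right _ _ tendsto_natCast_atTop_atTop)
    refine tendsto_of_tendsto_of_tendsto_of_le_of_le' tendsto_const_nhds hup ?_ ?_
    · filter_upwards [eventually_ge_atTop 2] with L hL
      have hL2 : (2 : ℝ) ≤ L := by exact_mod_cast hL
      exact div_nonneg (Real.log_natCast_nonneg _)
        (mul_nonneg (by linarith) (Real.log_nonneg (by linarith)))
    · filter_upwards [eventually_ge_atTop 2] with L hL
      have hL2 : (2 : ℝ) ≤ L := by exact_mod_cast hL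
      have hlog1 : 0 < Real.log ((L : ℝ) + 1) := Real.log_pos (by linarith)
      have hlogk : 0 ≤ Real.log k := Real.log_natCast_nonneg k
      have hnum : Real.log ((k * 2 ^ L : ℕ) : ℝ) ≤ Real.log k + L := by
        rcases Nat.eq_zero_or_pos k with rfl | hk
        · simp
        · have e : ((k * 2 ^ L : ℕ) : ℝ) = (k : ℝ) * 2 ^ L := by push_cast; ring
          rw [e, Real.log_mul (by positivity) (by positivity), Real.log_pow]
          have := Real.log_two_lt_d9
          have hL0 : (0 : ℝ) ≤ L := by positivity
          nlinarith
      calc Real.log ((k * 2 ^ L : ℕ) : ℝ) / (((L : ℝ) - 1) * Real.log ((L : ℝ) + 1))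
          ≤ (Real.log k + L) / (((L : ℝ) - 1) * Real.log ((L : ℝ) + 1)) :=
            div_le_div_of_nonneg_right hnum (mul_pos (by linarith) hlog1).le
        _ ≤ (Real.log k + 2) / Real.log ((L : ℝ) + 1) := by
            rw [div_le_div_iff₀ (mul_pos (by linarith) hlog1) hlog1]
            have hkey : Real.log k + L ≤ (Real.log k + 2) * ((L : ℝ) - 1) := by nlinarith
            calc (Real.log k + L) * Real.log ((L : ℝ) + 1)
                ≤ ((Real.log k + 2) * ((L : ℝ) - 1)) * Real.log ((L : ℝ) + 1) :=
                  mul_le_mul_of_nonneg_right hkey hlog1.le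
              _ = (Real.log k + 2) * (((L : ℝ) - 1) * Real.log ((L : ℝ) + 1)) := by ring
  have := (Real.continuous_exp.tendsto 0).comp hexp
  rw [Real.exp_zero] at this
  exact this

/-! ### Theorem 4: `S(k, L) / (2L^{2k}) → 1 + A(k)` -/

/-- **Pintz–Ruzsa I, Theorem 4, upper half**: for `k ≥ 1` and `ε > 0`, for all large `N`,
`S(k, L) = ∑_{m ≠ 0} r_{k,k}(m) σ(m) ≤ (C₀ ∑'_d κ(d) P_d(k) + ε) · 2L^{2k}`.
[cite: PintzRuzsa2003, §9 Theorem 4 (9.7)] -/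
theorem eventually_pairSingularSum_le {k : ℕ} (hk : 1 ≤ k) {ε : ℝ} (hε : 0 < ε) :
    ∀ᶠ N in atTop, pairSingularSum N k ≤
      (twinPrimeConst * (∑' d : ℕ, kappa d * residueProb d k) + ε) * (2 * (powLen N : ℝ) ^ (2 * k)) := by
  set S0 := ∑' d : ℕ, kappa d * residueProb d k with hS0
  have hC0 : (0 : ℝ) ≤ twinPrimeConst := le_trans (by norm_num) half_le_twinPrimeConst
  have hC1 : twinPrimeConst ≤ 1 := twinPrimeConst_le_one
  have hS00 : 0 ≤ S0 := tsum_nonneg fun d => kappa_mul_residueProb_nonneg d k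
  -- the tail of Romanov's series: choose `Z`
  have htail : Tendsto (fun n => ∑ d ∈ range n, kappa d / ordTwo d) atTop (𝓝 romanovConstPR) :=
    summable_kappa_div_ordTwo.hasSum.tendsto_sum_nat
  obtain ⟨Z, hZ⟩ : ∃ Z : ℕ, romanovConstPR - ∑ d ∈ range (Z + 1), kappa d / ordTwo d ≤ ε / 2 := by
    have hev := (tendsto_order.1 htail).1 (romanovConstPR - ε / 2) (by linarith)
    obtain ⟨n₀, hn₀⟩ := eventually_atTop.mp hev
    exact ⟨n₀, by have := hn₀ (n₀ + 1) (by omega); linarith⟩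
  -- the normalised bound `g(L)` and its limit
  have hg : Tendsto (fun L : ℕ => twinPrimeConst * largeOrdBound k L *
      ((1 + (Z : ℝ) / L) ^ (2 * k) * S0 + ε / 2 + Real.exp 14 * Real.log L ^ 2 / L)) atTop
      (𝓝 (twinPrimeConst * 1 * (1 * S0 + ε / 2 + 0))) :=
    (tendsto_const_nhds.mul (tendsto_largeOrdBound k)).mul
      ((((tendsto_one_add_div_pow Z (2 * k)).mul tendsto_const_nhds).add tendsto_const_nhds).add
        (tendsto_log_sq_div _))
  have hlim : twinPrimeConst * 1 * (1 * S0 + ε / 2 + 0) < twinPrimeConst * S0 + ε := by nlinarith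
  obtain ⟨L₀, hL₀⟩ := eventually_atTop.mp ((tendsto_order.1 hg).2 _ hlim)
  have hN : ∀ᶠ N in atTop, max L₀ 2 ≤ powLen N := (tendsto_atTop.mp tendsto_powLen) (max L₀ 2)
  filter_upwards [hN] with N hN
  have hL2 : 2 ≤ powLen N := le_of_max_le_right hN
  have hLL₀ : L₀ ≤ powLen N := le_of_max_le_left hN
  have hgL := hL₀ (powLen N) hLL₀
  have hLpos : (0 : ℝ) < powLen N := by exact_mod_cast (by omega : 0 < powLen N)
  have hL0 : (powLen N : ℝ) ≠ 0 := hLpos.ne'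
  have hδ : 0 ≤ largeOrdBound k (powLen N) := (Real.exp_pos _).le
  have e1 : ((powLen N : ℝ) + Z) ^ (2 * k) = (powLen N : ℝ) ^ (2 * k) * (1 + (Z : ℝ) / powLen N) ^ (2 * k) := by
    rw [← mul_pow]
    congr 1
    field_simp
  have e2 : (powLen N : ℝ) ^ (2 * k - 1) = (powLen N : ℝ) ^ (2 * k) / powLen N := by
    rw [eq_div_iff hL0, ← pow_succ]
    congr 1
    omega
  calc pairSingularSum N k ≤ _ := pairSingularSum_le_fixed hk N Z hL2
    _ = 2 * (powLen N : ℝ) ^ (2 * k) * (twinPrimeConst * largeOrdBound k (powLen N) *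
          ((1 + (Z : ℝ) / powLen N) ^ (2 * k) * S0 +
            (romanovConstPR - ∑ d ∈ range (Z + 1), kappa d / ordTwo d) +
            Real.exp 14 * Real.log (powLen N) ^ 2 / powLen N)) := by
        rw [e1, e2]
        ring
    _ ≤ 2 * (powLen N : ℝ) ^ (2 * k) * (twinPrimeConst * largeOrdBound k (powLen N) *
          ((1 + (Z : ℝ) / powLen N) ^ (2 * k) * S0 + ε / 2 +
            Real.exp 14 * Real.log (powLen N) ^ 2 / powLen N)) := by
        apply mul_le_mul_of_nonneg_left _ (by positivity)
        apply mul_le_mul_of_nonneg_left _ (mul_nonneg hC0 hδ)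
        linarith
    _ ≤ 2 * (powLen N : ℝ) ^ (2 * k) * (twinPrimeConst * S0 + ε) :=
        mul_le_mul_of_nonneg_left hgL.le (by positivity)
    _ = (twinPrimeConst * S0 + ε) * (2 * (powLen N : ℝ) ^ (2 * k)) := by ring

/-- **Pintz–Ruzsa I, Theorem 4, lower half**: for `k ≥ 1` and `ε > 0`, for all large `N`,
`(C₀ ∑'_d κ(d) P_d(k) - ε) · 2L^{2k} ≤ S(k, L)`. [cite: PintzRuzsa2003, §9 Theorem 4 (9.7)] -/
theorem eventually_le_pairSingularSum {k : ℕ} (hk : 1 ≤ k) {ε : ℝ} (hε : 0 < ε) :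
    ∀ᶠ N in atTop, (twinPrimeConst * (∑' d : ℕ, kappa d * residueProb d k) - ε) *
      (2 * (powLen N : ℝ) ^ (2 * k)) ≤ pairSingularSum N k := by
  classical
  set S0 := ∑' d : ℕ, kappa d * residueProb d k with hS0
  have hC0 : (1 : ℝ) / 2 ≤ twinPrimeConst := half_le_twinPrimeConst
  have hC1 : twinPrimeConst ≤ 1 := twinPrimeConst_le_one
  -- a finite part of the series: `n₀`
  have hsum : Tendsto (fun n => ∑ d ∈ range n, kappa d * residueProb d k) atTop (𝓝 S0) :=
    (summable_kappa_mul_residueProb hk).hasSum.tendsto_sum_nat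
  obtain ⟨n₀, hn₀⟩ : ∃ n₀, S0 - ε / 2 ≤ ∑ d ∈ range n₀, kappa d * residueProb d k := by
    have hev := (tendsto_order.1 hsum).1 (S0 - ε / 2) (by linarith)
    obtain ⟨n₀, h⟩ := eventually_atTop.mp hev
    exact ⟨n₀, (h n₀ le_rfl).le⟩
  set P := primesOrdLE n₀ with hP
  have hPpr : ∀ p ∈ P, p.Prime := fun p hp => (mem_primesOrdLE.mp hp).1
  -- every odd square-free `d < n₀` is a `d_T`, `T ⊆ P`
  have hpart : ∑ d ∈ range n₀, kappa d * residueProb d k ≤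
      ∑ T ∈ P.powerset, kappa (setProd T) * residueProb (setProd T) k := by
    rw [← Finset.sum_image (f := fun d => kappa d * residueProb d k) (setProd_injOn hPpr),
      ← Finset.sum_filter_add_sum_filter_not (range n₀) (fun d => Odd d ∧ Squarefree d)]
    have h0 : ∑ d ∈ (range n₀).filter (fun d => ¬ (Odd d ∧ Squarefree d)), kappa d * residueProb d k = 0 :=
      Finset.sum_eq_zero fun d hd => by rw [kappa_apply, if_neg (Finset.mem_filter.mp hd).2, zero_mul]
    rw [h0, add_zero]
    refine Finset.sum_le_sum_of_subset_of_nonneg (fun d hd => ?_) fun d _ _ => kappa_mul_residueProb_nonneg d k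
    rw [Finset.mem_filter, Finset.mem_range] at hd
    obtain ⟨hdn, hodd, hsq⟩ := hd
    have hd0 : d ≠ 0 := by rintro rfl; exact (Nat.not_odd_zero hodd).elim
    rw [Finset.mem_image]
    refine ⟨d.primeFactors, ?_, Nat.prod_primeFactors_of_squarefree hsq⟩
    rw [Finset.mem_powerset]
    intro p hp
    have hpp := Nat.prime_of_mem_primeFactors hp
    have hpd := Nat.dvd_of_mem_primeFactors hp
    refine mem_primesOrdLE.mpr ⟨hpp, hodd.of_dvd_nat hpd, ?_⟩
    calc ordTwo p ≤ p := ordTwo_le_self hpp.ne_zero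
      _ ≤ d := Nat.le_of_dvd (Nat.pos_of_ne_zero hd0) hpd
      _ ≤ n₀ := hdn.le
  set M₀ := P.powerset.sup (fun T => ordTwo (setProd T)) with hM₀
  have hM : ∀ T ∈ P.powerset, ordTwo (setProd T) ≤ M₀ := fun T hT =>
    Finset.le_sup (f := fun T => ordTwo (setProd T)) hT
  set K₀ := ∏ p ∈ P, (1 + 1 / ((p : ℝ) - 2)) with hK₀
  set SP := ∑ T ∈ P.powerset, kappa (setProd T) * residueProb (setProd T) k with hSP
  have hg : Tendsto (fun L : ℕ => twinPrimeConst * ((1 - (M₀ : ℝ) / L) ^ (2 * k) * SP - K₀ / L)) atTop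
      (𝓝 (twinPrimeConst * (1 * SP - 0))) :=
    tendsto_const_nhds.mul (((tendsto_one_sub_div_pow M₀ (2 * k)).mul tendsto_const_nhds).sub
      (tendsto_const_div_natCast K₀))
  have hlim : twinPrimeConst * S0 - ε < twinPrimeConst * (1 * SP - 0) := by
    have : S0 - ε / 2 ≤ SP := hn₀.trans hpart
    nlinarith
  obtain ⟨L₀, hL₀⟩ := eventually_atTop.mp ((tendsto_order.1 hg).1 _ hlim)
  have hN : ∀ᶠ N in atTop, max L₀ (max M₀ 1) ≤ powLen N := (tendsto_atTop.mp tendsto_powLen) _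
  filter_upwards [hN] with N hN
  have hLL₀ : L₀ ≤ powLen N := le_of_max_le_left hN
  have hML : M₀ ≤ powLen N := le_of_max_le_left (le_of_max_le_right hN)
  have hL1 : 1 ≤ powLen N := le_of_max_le_right (le_of_max_le_right hN)
  have hLpos : (0 : ℝ) < powLen N := by exact_mod_cast hL1
  have hL0 : (powLen N : ℝ) ≠ 0 := hLpos.ne'
  have hgL := hL₀ (powLen N) hLL₀
  have e1 : ((powLen N : ℝ) - M₀) ^ (2 * k) =
      (powLen N : ℝ) ^ (2 * k) * (1 - (M₀ : ℝ) / powLen N) ^ (2 * k) := by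
    rw [← mul_pow]
    congr 1
    field_simp
  have e2 : (powLen N : ℝ) ^ (2 * k - 1) = (powLen N : ℝ) ^ (2 * k) / powLen N := by
    rw [eq_div_iff hL0, ← pow_succ]
    congr 1
    omega
  calc (twinPrimeConst * S0 - ε) * (2 * (powLen N : ℝ) ^ (2 * k))
      ≤ (2 * (powLen N : ℝ) ^ (2 * k)) *
          (twinPrimeConst * ((1 - (M₀ : ℝ) / powLen N) ^ (2 * k) * SP - K₀ / powLen N)) := by
        rw [mul_comm]
        exact mul_le_mul_of_nonneg_left hgL.le (by positivity)
    _ = 2 * twinPrimeConst * (((powLen N : ℝ) - M₀) ^ (2 * k) * SP - (powLen N : ℝ) ^ (2 * k - 1) * K₀) := by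
        rw [e1, e2]
        field_simp
    _ ≤ pairSingularSum N k := pairSingularSum_ge_fixed hk N n₀ M₀ hML hM

/-- **Pintz–Ruzsa I, Theorem 4 (Khalfalah–Pintz), the limit (9.7) exists and is the explicit series**:
for `k ≥ 1`, `S(k, L) / (2L^{2k}) → C₀ ∑'_{d odd, square-free} k(d) P_d(k) = 1 + A(k)` as
`N → ∞` (`L = [log₂ N]`). [cite: PintzRuzsa2003, §9 Theorem 4 (9.7)] -/
theorem tendsto_pairSingularSum_div {k : ℕ} (hk : 1 ≤ k) :
    Tendsto (fun N => pairSingularSum N k / (2 * (powLen N : ℝ) ^ (2 * k))) atTop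
      (𝓝 (twinPrimeConst * ∑' d : ℕ, kappa d * residueProb d k)) := by
  set ℓ := twinPrimeConst * ∑' d : ℕ, kappa d * residueProb d k with hℓ
  have hL : ∀ᶠ N in atTop, 1 ≤ powLen N := (tendsto_atTop.mp tendsto_powLen) 1
  rw [tendsto_order]
  constructor
  · intro a ha
    filter_upwards [eventually_le_pairSingularSum hk (half_pos (sub_pos.mpr ha)), hL] with N hN hL1
    have hpos : (0 : ℝ) < 2 * (powLen N : ℝ) ^ (2 * k) := by
      have : (1 : ℝ) ≤ powLen N := by exact_mod_cast hL1
      positivity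
    rw [lt_div_iff₀ hpos]
    calc a * (2 * (powLen N : ℝ) ^ (2 * k)) < (ℓ - (ℓ - a) / 2) * (2 * (powLen N : ℝ) ^ (2 * k)) :=
          mul_lt_mul_of_pos_right (by linarith) hpos
      _ ≤ pairSingularSum N k := hN
  · intro b hb
    filter_upwards [eventually_pairSingularSum_le hk (half_pos (sub_pos.mpr hb)), hL] with N hN hL1
    have hpos : (0 : ℝ) < 2 * (powLen N : ℝ) ^ (2 * k) := by
      have : (1 : ℝ) ≤ powLen N := by exact_mod_cast hL1
      positivity
    rw [div_lt_iff₀ hpos]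
    calc pairSingularSum N k ≤ (ℓ + (b - ℓ) / 2) * (2 * (powLen N : ℝ) ^ (2 * k)) := hN
      _ < b * (2 * (powLen N : ℝ) ^ (2 * k)) := mul_lt_mul_of_pos_right (by linarith) hpos

/-- **Theorem 4, (9.7) verbatim**: `S(k,L)/(2L^{2k}) - 1 → A(k)`. [cite: PintzRuzsa2003, §9 Theorem 4 (9.7)] -/
theorem tendsto_pairSingularSum_div_sub_one {k : ℕ} (hk : 1 ≤ k) :
    Tendsto (fun N => pairSingularSum N k / (2 * (powLen N : ℝ) ^ (2 * k)) - 1) atTop (𝓝 (aConst k)) :=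
  (tendsto_pairSingularSum_div hk).sub_const 1

/-- **The form used in (10.4)**: for `k ≥ 1`, `ε > 0` and all large `N`,
`∑_{m ≠ 0} r_{k,k}(m) σ(m) ≤ 2L^{2k} (1 + A(k) + ε)`. [cite: PintzRuzsa2003, §9 Theorem 4, §10 (10.4)] -/
theorem eventually_pairSingularSum_le_aConst {k : ℕ} (hk : 1 ≤ k) {ε : ℝ} (hε : 0 < ε) :
    ∀ᶠ N in atTop, pairSingularSum N k ≤ 2 * (powLen N : ℝ) ^ (2 * k) * (1 + aConst k + ε) := by
  filter_upwards [eventually_pairSingularSum_le hk hε] with N hN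
  have e : 1 + aConst k = twinPrimeConst * ∑' d : ℕ, kappa d * residueProb d k := by
    unfold aConst; ring
  rw [e, mul_comm]
  exact hN

/-- **`A(1)`**: `1 + A(1) = C₀ R₀` (`P_d(1) = 1/ϱ(d)`), linking Theorem 4 at `k = 1` with Romanov's
constant `R₀` of (8.14). [cite: PintzRuzsa2003, §8 (8.14), §9 Theorem 4] -/
theorem one_add_aConst_one : 1 + aConst 1 = twinPrimeConst * romanovConstPR := by
  unfold aConst romanovConstPR
  have e : (fun d : ℕ => kappa d * residueProb d 1) = fun d => kappa d / ordTwo d := by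
    funext d
    rw [kappa_apply]
    split_ifs with h
    · rw [residueProb_one h.1, mul_one_div]
    · rw [zero_mul, zero_div]
  rw [e]
  ring

/-- **`1 + A(k) ≤ C₀ R₀`** for `k ≥ 1` (`P_d(k) ≤ 1/ϱ(d)`); with `one_add_aConst_one`, `A(k) ≤ A(1)`.
[cite: PintzRuzsa2003, §9 Theorem 4] -/
theorem one_add_aConst_le {k : ℕ} (hk : 1 ≤ k) : 1 + aConst k ≤ twinPrimeConst * romanovConstPR := by
  unfold aConst romanovConstPR
  have hC0 : (0 : ℝ) ≤ twinPrimeConst := le_trans (by norm_num) half_le_twinPrimeConst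
  have h := Summable.tsum_le_tsum (kappa_mul_residueProb_le hk) (summable_kappa_mul_residueProb hk)
    summable_kappa_div_ordTwo
  have := mul_le_mul_of_nonneg_left h hC0
  linarith


/-! ### `A(k)` decreases with `k` -/

section Monotone

variable {d : ℕ} [NeZero d]

/-- The `k`-tuples of residues `mod ϱ(d)` with `∑ 2^{a_i} ≡ c (mod d)`. [folklore] -/
def residueFibre (d : ℕ) [NeZero d] (k : ℕ) (c : ZMod d) : Finset (Fin k → ℕ) :=
  (Fintype.piFinset fun _ : Fin k => range (ordTwo d)).filter fun a => (tupleSum a : ZMod d) = c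

/-- Shifted coincidences: `#{(a, b) : ∑2^{a_i} + u ≡ ∑2^{b_i} + v} = ∑_c #fibre(c) · #fibre(c + u - v)`.
[folklore] -/
theorem card_filter_shift_eq (k : ℕ) (u v : ZMod d) :
    (((Fintype.piFinset fun _ : Fin k => range (ordTwo d)) ×ˢ
        (Fintype.piFinset fun _ : Fin k => range (ordTwo d))).filter
        fun z => (tupleSum z.1 : ZMod d) + u = (tupleSum z.2 : ZMod d) + v).card =
      ∑ c : ZMod d, (residueFibre d k c).card * (residueFibre d k (c + u - v)).card := by
  classical
  set A := Fintype.piFinset fun _ : Fin k => range (ordTwo d) with hA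
  rw [Finset.card_eq_sum_card_fiberwise (f := fun z : (Fin k → ℕ) × (Fin k → ℕ) => (tupleSum z.1 : ZMod d))
    (t := Finset.univ) fun z _ => Finset.mem_univ _]
  refine Finset.sum_congr rfl fun c _ => ?_
  rw [← Finset.card_product]
  congr 1
  ext z
  simp only [residueFibre, Finset.mem_filter, Finset.mem_product, ← hA]
  constructor
  · rintro ⟨⟨⟨h1, h2⟩, heq⟩, hc⟩
    refine ⟨⟨h1, hc⟩, h2, ?_⟩
    rw [← hc]
    exact (eq_sub_of_add_eq heq.symm)
  · rintro ⟨⟨h1, hc⟩, h2, hc'⟩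
    refine ⟨⟨⟨h1, h2⟩, ?_⟩, hc⟩
    rw [hc, hc']
    abel

/-- **Shifted coincidences are fewer than coincidences**:
`#{(a,b) : ∑2^{a_i} + u ≡ ∑2^{b_i} + v} ≤ #residueSolutions d k` (`2xy ≤ x² + y²` and the translation
invariance of `∑_c #fibre(c)²`); for any `d ≠ 0`. [folklore] -/
theorem card_filter_shift_le (k : ℕ) (u v : ZMod d) :
    (((Fintype.piFinset fun _ : Fin k => range (ordTwo d)) ×ˢ
        (Fintype.piFinset fun _ : Fin k => range (ordTwo d))).filter
        fun z => (tupleSum z.1 : ZMod d) + u = (tupleSum z.2 : ZMod d) + v).card ≤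
      (residueSolutions d k).card := by
  classical
  have hR : (residueSolutions d k).card = ∑ c : ZMod d, (residueFibre d k c).card * (residueFibre d k c).card := by
    have h := card_filter_shift_eq (d := d) k 0 0
    simp only [add_zero, sub_zero] at h
    rw [← h]
    unfold residueSolutions
    congr 1
    ext z
    simp only [Finset.mem_filter, ZMod.natCast_eq_natCast_iff']
  rw [card_filter_shift_eq, hR]
  -- `2 ∑ x_c y_c ≤ ∑ x_c² + ∑ y_c²` and `∑_c y_c² = ∑_c x_c²`
  have hshift : ∑ c : ZMod d, (residueFibre d k (c + u - v)).card * (residueFibre d k (c + u - v)).card =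
      ∑ c : ZMod d, (residueFibre d k c).card * (residueFibre d k c).card := by
    have : (fun c : ZMod d => c + u - v) = fun c => c + (u - v) := by funext c; abel
    simp_rw [show ∀ c : ZMod d, c + u - v = c + (u - v) from fun c => by abel]
    exact Fintype.sum_equiv (Equiv.addRight (u - v)) _ _ fun c => rfl
  have key : 2 * ∑ c : ZMod d, (residueFibre d k c).card * (residueFibre d k (c + u - v)).card ≤
      ∑ c : ZMod d, (residueFibre d k c).card * (residueFibre d k c).card +
        ∑ c : ZMod d, (residueFibre d k (c + u - v)).card * (residueFibre d k (c + u - v)).card := by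
    rw [Finset.mul_sum, ← Finset.sum_add_distrib]
    refine Finset.sum_le_sum fun c _ => ?_
    nlinarith [Nat.zero_le ((residueFibre d k c).card), sq_nonneg ((residueFibre d k c).card - (residueFibre d k (c + u - v)).card : ℤ)]
  rw [hshift] at key
  omega

/-- **`#residueSolutions d (k+1) ≤ ϱ(d)² · #residueSolutions d k`** (`d ≠ 0`): fixing the first
exponents `a₁ = h`, `b₁ = h'` leaves shifted coincidences of `k`-tuples. [folklore] -/
theorem card_residueSolutions_succ_le (k : ℕ) :
    (residueSolutions d (k + 1)).card ≤ ordTwo d ^ 2 * (residueSolutions d k).card := by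
  classical
  set ρ := ordTwo d with hρ
  set A := Fintype.piFinset fun _ : Fin k => range ρ with hA
  rw [Finset.card_eq_sum_card_fiberwise
    (f := fun z : (Fin (k + 1) → ℕ) × (Fin (k + 1) → ℕ) => (z.1 0, z.2 0)) (t := range ρ ×ˢ range ρ)
    fun z hz => by
      rw [Finset.mem_coe, mem_residueSolutions] at hz
      rw [Finset.mem_coe, Finset.mem_product, Finset.mem_range, Finset.mem_range]
      exact ⟨hz.1 0, hz.2.1 0⟩]
  calc ∑ w ∈ range ρ ×ˢ range ρ, ((residueSolutions d (k + 1)).filter fun z => (z.1 0, z.2 0) = w).card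
      ≤ ∑ _w ∈ range ρ ×ˢ range ρ, (residueSolutions d k).card := by
        refine Finset.sum_le_sum fun w _ => ?_
        obtain ⟨wh, wh'⟩ := w
        calc ((residueSolutions d (k + 1)).filter fun z => (z.1 0, z.2 0) = (wh, wh')).card
            ≤ ((A ×ˢ A).filter fun z => (tupleSum z.1 : ZMod d) + (2 ^ wh : ℕ) =
                (tupleSum z.2 : ZMod d) + (2 ^ wh' : ℕ)).card := by
              refine Finset.card_le_card_of_injOn (fun z => (fun i => z.1 i.succ, fun i => z.2 i.succ))
                (fun z hz => ?_) fun z hz z' hz' hzz => ?_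
              · rw [Finset.mem_coe, Finset.mem_filter, mem_residueSolutions] at hz
                obtain ⟨⟨h1, h2, h3⟩, hw⟩ := hz
                simp only [Prod.mk.injEq] at hw
                rw [Finset.mem_coe, Finset.mem_filter, Finset.mem_product, hA, Fintype.mem_piFinset,
                  Fintype.mem_piFinset]
                refine ⟨⟨fun i => Finset.mem_range.mpr (h1 _), fun i => Finset.mem_range.mpr (h2 _)⟩, ?_⟩
                have h3' : ((tupleSum z.1 : ℕ) : ZMod d) = tupleSum z.2 :=
                  (ZMod.natCast_eq_natCast_iff' _ _ _).mpr h3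
                rw [tupleSum_succ, tupleSum_succ, hw.1, hw.2] at h3'
                push_cast at h3' ⊢
                have e1 : (tupleSum (fun i => z.1 i.succ) : ZMod d) = ∑ i : Fin k, (2 : ZMod d) ^ z.1 i.succ := by
                  unfold tupleSum; push_cast; rfl
                have e2 : (tupleSum (fun i => z.2 i.succ) : ZMod d) = ∑ i : Fin k, (2 : ZMod d) ^ z.2 i.succ := by
                  unfold tupleSum; push_cast; rfl
                rw [e1, e2, add_comm, add_comm (∑ i : Fin k, (2 : ZMod d) ^ z.2 i.succ)]
                exact h3'
              · rw [Finset.mem_coe, Finset.mem_filter] at hz hz'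
                simp only [Prod.mk.injEq] at hzz
                have hw := hz.2
                have hw' := hz'.2
                simp only [Prod.mk.injEq] at hw hw'
                exact Prod.ext (eq_of_apply_zero_eq_of_tail_eq (hw.1.trans hw'.1.symm) hzz.1)
                  (eq_of_apply_zero_eq_of_tail_eq (hw.2.trans hw'.2.symm) hzz.2)
          _ ≤ (residueSolutions d k).card := card_filter_shift_le k _ _
    _ = ρ ^ 2 * (residueSolutions d k).card := by
        rw [Finset.sum_const, Finset.card_product, Finset.card_range, smul_eq_mul, sq]

end Monotone

/-- **`P_d(k+1) ≤ P_d(k)`** for odd `d`. [cite: KhalfalahPintz2006, Theorem 1] -/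
theorem residueProb_succ_le {d : ℕ} (hd : Odd d) (k : ℕ) : residueProb d (k + 1) ≤ residueProb d k := by
  have hd0 : d ≠ 0 := by rintro rfl; exact (Nat.not_odd_zero hd).elim
  haveI : NeZero d := ⟨hd0⟩
  have hρ : (0 : ℝ) < ordTwo d := by exact_mod_cast ordTwo_pos hd
  unfold residueProb
  rw [div_le_div_iff₀ (by positivity) (by positivity)]
  have h := card_residueSolutions_succ_le (d := d) k
  have h' : ((residueSolutions d (k + 1)).card : ℝ) ≤ (ordTwo d : ℝ) ^ 2 * (residueSolutions d k).card := by
    exact_mod_cast h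
  calc ((residueSolutions d (k + 1)).card : ℝ) * (ordTwo d : ℝ) ^ (2 * k)
      ≤ (ordTwo d : ℝ) ^ 2 * (residueSolutions d k).card * (ordTwo d : ℝ) ^ (2 * k) := by gcongr
    _ = (residueSolutions d k).card * (ordTwo d : ℝ) ^ (2 * (k + 1)) := by ring

/-- **Theorem 4: `A(k)` decreases with `k`** (`A(k+1) ≤ A(k)` for `k ≥ 1`).
[cite: PintzRuzsa2003, §9 Theorem 4] [cite: KhalfalahPintz2006, Theorem 1] -/
theorem aConst_succ_le {k : ℕ} (hk : 1 ≤ k) : aConst (k + 1) ≤ aConst k := by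
  unfold aConst
  have hC0 : (0 : ℝ) ≤ twinPrimeConst := le_trans (by norm_num) half_le_twinPrimeConst
  have h : ∑' d : ℕ, kappa d * residueProb d (k + 1) ≤ ∑' d : ℕ, kappa d * residueProb d k := by
    refine Summable.tsum_le_tsum (fun d => ?_) (summable_kappa_mul_residueProb (by omega))
      (summable_kappa_mul_residueProb hk)
    rw [kappa_apply]
    split_ifs with hds
    · exact mul_le_mul_of_nonneg_left (residueProb_succ_le hds.1 k) (kWeight_nonneg hds.1)
    · rw [zero_mul, zero_mul]
  have := mul_le_mul_of_nonneg_left h hC0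
  linarith

/-- `A(l) ≤ A(k)` for `1 ≤ k ≤ l`. [cite: PintzRuzsa2003, §9 Theorem 4] -/
theorem aConst_le_aConst {k l : ℕ} (hk : 1 ≤ k) (hkl : k ≤ l) : aConst l ≤ aConst k := by
  induction l, hkl using Nat.le_induction with
  | base => exact le_rfl
  | succ l hkl ih => exact (aConst_succ_le (hk.trans hkl)).trans ih

end PintzRuzsa2003

end Literature.NumberTheory.Sieve
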